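import Literature.MathematicalPhysics.QuantumFieldTheory.Borinsky2020.KirchhoffPermutahedron
import Literature.MathematicalPhysics.QuantumFieldTheory.IncidenceMatrixRank
import HarnessLib

/-!
# The Newton polytope of the second Symanzik polynomial `Φ_G` IS the generalized permutahedron `𝒢_{z_Φ}`, `z_Φ(γ) = ℓ(γ) + δ_{m.m.}(γ)` supermodular — Borinsky 2020 Theorem 32 (journal Thm 7.1), the `Φ`-part = Borinsky–Munch–Tellander 2023 Theorem 3.5 = Schultka 2018 Theorem 4.15 (Euclidean, generic kinematics) — PROVED; with the Hepp-sector monomial `Φ^tr_G|_{Exp C_σ} = (Π_{e∉T_σ} x_e) · x_{e*}` and §7.2's `𝒜`, `ℬ`, `r_G = ω(γ) − ω(G) δ_{m.m.}(γ)` from graph data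

independent recomputation; certified where stated, statistical where stated; no new-physics claim.

CITATION HEADER (venture `QEDPrecision`, cell `pub-qed`, track TROPICAL, LIT seat `pub-qed-trop-lit` gen 30; VALUE-FREE: statements
about the Newton polytope of the second Symanzik polynomial of an arbitrary connected edge list with Euclidean kinematic data — no
integral is evaluated, nothing per word, nothing of any Set V family). It closes the item the companion `KirchhoffPermutahedron.lean`
lists first under NOT typed: "the `Φ_G`-part of Theorem 32 (z_Φ, mass-momentum spanning subgraphs, Euclidean non-exceptional
kinematics; BMT23 Theorems 3.4–3.6 …) — the tree has no second Symanzik polynomial with kinematics here". This file DEFINES that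
polynomial (Borinsky's eq. (PsiPhi_slow)) together with Brown's spanning 2-trees, momentum-spanning / mass-momentum-spanning
subgraphs and generic momenta, and proves the theorem in the hypothesis format `(Σ_j ρ_j • NP⟦b_j⟧) = gpPolytope z_ℬ` that
`GeneralizedPermutahedronSampling.lean` / `ConvergenceTheorem.lean` / `TropicalNormalizationHeppBound.lean` consume.

SOURCES, VERBATIM. [Borinsky2020] M. Borinsky, "Tropical Monte Carlo quadrature for Feynman integrals", Ann. Inst. Henri Poincaré
D 10 (2023) 635–685 = arXiv:2008.12310v2 (LaTeX e-print held by the cell, HOME `data/lit/sources/.cache/2008.12310/tropical.tex`;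
e-print flat theorem counter as in all companions; journal: Theorem 32 = Thm 7.1, Lemma 25 = Lemma 6.4, Lemma 26 = Lemma 6.5,
Theorem 27 = Thm 6.6), §7.1 eq. (PsiPhi_slow) (l.1185–1187): "Ψ_G(x) = Σ_{T_1} Π_{e∉T_1} x_e, Φ_G(x) = Σ_{T_2} ‖p(T_2)‖² Π_{e∉T_2}
x_e + Ψ_G Σ_e x_e m_e², where p(T_2) is the total momentum flowing between the two components of the 2-forest T_2. Only the Φ_G(x)
polynomial depends on the external physical parameters: a set of momenta p^{(1)}, …, p^{(V)} ∈ ℝ^D incoming into each of the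
vertices and a set of masses m_1, …, m_E ∈ ℝ associated to the edges of the graph"; l.1195: "A subgraph γ ⊂ G is called
mass-momentum-spanning (m.m.) in G if the second Symanzik polynomial of the contracted graph G/γ vanishes Φ_{G/γ} = 0.
Mass-momentum-spanning graphs can also be defined combinatorially as subgraphs that contain all massive edges and one connected
component which connects all vertices with non-zero incoming momentum. See [Brown, Definition 2.6]"; **Theorem 32** (l.1197–1202):
"If we restrict to Euclidean and non-exceptional kinematics, then the Newton polytope of Ψ_G and Φ_G are generalized permutahedra.
A facet presentation of these polytopes is given by the supermodular functions z_{Ψ_G}(γ) = ℓ(γ), z_{Φ_G}(γ) = ℓ(γ)+1 if γ is m.m.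
in G, ℓ(γ) else, for all subgraphs γ ⊂ Γ."; l.1203–1206: "See [Brown, Section 1.7] for a definition of non-exceptional or generic
kinematics. Briefly, this condition ensures that there is no non-trivial combination of the external momenta that adds up to 0. …
With this generalization it is sufficient to require that any external momenta are non-zero."; proof (l.1207–1213): "Theorem 32
has been proven by Schultka [Theorem 4.15] using results from Brown. The first statement … can be traced back to Hepp and Speer,
who realized that a complete ordering of the integration parameters … is sufficient to capture the relevant singularities of
parametric integrals in the Euclidean non-exceptional case."; §7.2 (l.1237–1241): "𝒜 = Σ_e ν_e NP_{p_e} + ω(G) NP_{Ψ_G}, ℬ = ½ D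
NP_{Ψ_G} + ω(G) NP_{Φ_G} if ω(G) ≥ 0 … r_G(γ) = z_𝒜(γ) − z_ℬ(γ) = Σ_e ν_e z_{p_e}(γ) − (D/2) z_{Ψ_G}(γ) + ω(G)(z_{Ψ_G}(γ) −
z_{Φ_G}(γ)) = Σ_{e∈γ} ν_e − (D/2) ℓ(γ) − ω(G) δ_{m.m.}(γ) for all non-empty γ ⊂ G, where we used Lemma 25 and Theorem 32 and where
δ_{m.m.}(γ) = 1 if γ is mass-momentum-spanning and 0 otherwise. Note that up to the δ_{m.m.}-term the function r_G(γ) is equal to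
the superficial degree of divergence ω(γ) of a subgraph." [BorinskyMunchTellander2023] M. Borinsky, H. J. Munch, F. Tellander,
"Tropical Feynman integration in the Minkowski regime", Comput. Phys. Commun. 292 (2023) 108874 = arXiv:2302.08955v2 (HOME
`data/lit/sources/.cache/2302.08955/main.tex`), §3.3 (l.733–736): "We use the following slightly generalized version of Brown's
definition …: We call a subgraph γ ⊂ E mass-momentum spanning if the second Symanzik polynomial of the cograph G/γ vanishes
identically ℱ_{G/γ} = 0."; [NUMBERING as printed in arXiv v2 / CPC 292: §3's one counter is shared by Theorem 3.1, Assumption 3.2, Theorem 3.3 (Aguiar–Ardila, «we will take Theorem 3.3 as our definition»), Theorem 3.4 (𝒰), **Theorem 3.5 (ℱ)**, Theorem 3.6 (all regimes), Conjecture 3.7, Observation 3.8, Theorem 3.9 («We have N[ℱ] ⊂ P[z_ℱ]», l.855–859); the first landing of this file (p394137) printed every BMT23 number one too low — corrected by the same seat, g30, tex line locators unchanged] **Theorem 3.5** (thm:FGP, l.740–752): "In the Euclidean regime with generic kinematics, the Newton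
polytope N[ℱ] is a generalized permutahedron. It is equal to the base polytope P[z_ℱ] with the function z_ℱ defined for all
subgraphs γ by z_ℱ(γ) = L_γ + 1 if γ is mass-momentum spanning and z_ℱ(γ) = L_γ otherwise. Consequently, this function z_ℱ :
2^E → ℝ is supermodular, i.e. it fulfills (supermod). Proof. This has also been proven in [Schultka, Sec. 4]. The proof relies on
a special infrared factorization property of ℱ that was discovered by Brown [Theorem 2.7]."; **Theorem 3.6** (l.766–779):
"Theorem 3.5 holds in all regimes if the kinematics are generic. Proof. The ℱ polynomial has the same monomials (with different
coefficients) as in the Euclidean regime with generic kinematics …"; **Conjecture 3.7** (l.782–787): "Theorem 3.5 holds in the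
Euclidean regime for all (also exceptional) kinematics." [Brown2017] F. Brown, "Feynman amplitudes, coaction principle, and cosmic
Galois group", Commun. Number Theory Phys. 11 (2017) 453–556 = arXiv:1512.06409 (held `paper:arxiv-1512.06409`, corpus chunks
p0007–p0013, p0026), §1.1 (p0007:L22–L25): "all momenta are incoming and are subject to momentum conservation Σ_{i∈E^ext_G} q_i =
0"; (p0007:L67–L69): "If a vertex v ∈ V_G has several incoming momenta q_1,…,q_n we can replace it with a single incoming momentum
q_1 + … + q_n"; (p0007:L48): "external legs which would ordinarily be considered to have zero incoming momentum will simply be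
omitted"; **Def. 1.2** (p0007:L86): "A spanning k-tree of G is a subgraph T = T_1 ∪ … ∪ T_k ⊂ G which has exactly k components
T_i such that T_i is a tree and V_T = V_G."; **Def. 1.3** / eq. (phidefn) (p0007:L93–L106, p0008:L1): "Ψ_G = Σ_{T⊂G} Π_{e∉T}
α_e … Φ_G(q) = Σ_{T_1∪T_2⊂G} (q^{T_1})² Π_{e∉T_1∪T_2} α_e, where the sum is over all spanning 2-trees T = T_1 ∪ T_2 of G and
q^{T_1} = Σ_{i∈E^ext_{T_1}} q_i is the total momentum entering T_1. It equals −q^{T_2} by momentum conservation"; **Def. 1.4**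
(p0008:L28–L33): "Ξ_G(q,m) = Φ_G(q) + (Σ_{e∈E_G} m_e² α_e) Ψ_G"; **Def. 1.8** (p0009:L10–L11): "A set of edges γ ⊂ E_G is
momentum-spanning if ∂E^ext_G ⊂ V_γ, and the vertices E^ext_G lie in a single connected component of the graph (V_γ, E_γ).";
§1.6 eq. (genericmomenta) (p0010:L8–L11): "(Σ_{i∈I} q_i)² ≠ 0 for all I ⊊ E^ext_G"; **Lemma 1.12** (p0010:L14–L20): "Let G be a
Feynman graph with non-trivial external momenta … Then with condition (genericmomenta), Φ_G(q) ≠ 0. Proof. By momentum conservation,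
there exist at least two vertices v_1, v_2 with non-zero total incoming momenta … there exists a spanning tree T … Delete any edge e'
in this path to obtain a spanning 2-tree T∖e' = T_1 ∪ T_2 such that v_1 ∈ V_{T_1} and v_2 ∈ V_{T_2}. It contributes a non-zero
monomial (q^{T_1})² Π_{e∉T_1∪T_2} α_e … by (genericmomenta). It cannot cancel out since all signs in the definition of Φ_{G_0}(q) are
positive."; **Lemma 1.13** (p0010:L28–L29): "If (genericmomenta) and (genericmassmomenta) hold then Ξ_G(q,m) = 0 if and only if G
has no massive edges, and no incoming momenta"; **Def. 2.6** (p0013:L60–L62): "A subgraph γ ⊂ G is mass-spanning if it contains all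
massive edges of G … We shall say that a subgraph γ is mass-momentum spanning (or simply m.m. for short) if it is both mass and
momentum-spanning."; **Prop. 2.4**, proof (p0013:L1–L4): "Monomials in Φ_G(q) are in one-to-one correspondence with spanning
2-trees T = T_1 ∪ T_2 such that (q^{T_1})² ≠ 0. For such a 2-tree, T ∩ γ' cannot be connected because each component T_i
intersects γ' non-trivially (otherwise … q^{T_i} = 0 because γ' is momentum-spanning)"; **Lemma 6.1 (i)** (p0026:L47): "if γ is
mass-momentum spanning in G, then so too is Γ [⊇ γ]". [Schultka2018] K. Schultka, "Toric geometry and regularization of Feynman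
integrals", arXiv:1806.01086 (HOME `data/lit/sources/.cache/1806.01086/toricfeynman.tex`; theorems numbered within §4 by the
shared counter, l.42–51): **Def. 4.3** (l.2064–2072): "A Feynman Graph G has generic euclidean kinematics, if Re(Σ_{i∈I} q_i)² > 0,
Re(Σ_{i∈I} q_i)² + Re(m_e²) > 0 for all proper subsets I ⊊ V^ext_G and massive edges e ∈ E^m_G."; **Def. 4.10** (l.2205–2209):
"An edge subgraph γ ⊂ G containing all external vertices of G in a single connected component will be called momentum spanning.
If γ additionally contains all massive edges, then it will be called mass-momentum spanning (m.m. for short)."; after **Cor.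
4.12** (l.2319–2324): "s_G(γ) = 2h¹(γ) + δ^{mm}_γ"; (l.2342–2347): "Let us also call a pair (T,i) of a spanning tree T ⊂ G and an
edge i ∈ E_G admissible if either i ∈ E^M_G or i ∈ T and both connected components of T∖i contain external momenta. Hence a pair
(T,i) is admissible if and only if the monomial α_i Π_{j∉T} α_j appears in Φ_G."; **Prop. 4.13** (l.2349–2351): "The function s_G
is supermodular." (proof l.2353–2377: "… with equality only if T ∩ γ_1 and T ∩ γ_2 are maximal forests … γ_1 ∩ γ_2 must also be
mass-momentum spanning"); **Theorem 4.15** (l.2409–2411): "The Feynman polytope P_G [= the Newton polytope of ψ_G Φ_G, Def. 4.9] is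
the generalized permutahedron associated to the function s_G." [Biggs1974] N. Biggs, *Algebraic Graph Theory*, Ch. 4 Def. 4.2 /
Prop. 4.3 (the incidence matrix and its rank `n − c`), as typed in `IncidenceMatrixRank.lean`. [Panzer2022] E. Panzer, AIHPD 10
(2023) 31–119, §2.2 Lemma 2.8 / eq. (∗) (Kruskal's tree of an order), as typed in `HeppSectorDominance.lean` /
`KirchhoffPermutahedron.lean`. [Oxley2011] J. Oxley, *Matroid Theory*, §1.1 (independent sets of `M(G)`), as typed in
`CycleMatroidSpanningTrees.lean`.

TYPING (new definitions, each with its printed sentence in the docstring; everything else is the companions' vocabulary). Edge lists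
`E : Fin N → Fin (V+1) × Fin (V+1)`; `edgeRank`, `loopNumber E γ = ℓ(γ)`, `IsConnectedEdgeList` (`GraphPeriod.lean`), `IsSpanningTree`
(`HeppBound.lean`), `edgeGraph E γ` = the graph spanned by `γ` on all vertices with Mathlib's `SimpleGraph.Reachable`
(`IncidenceMatrixRank.lean`), `kirchhoffPolynomial ℝ E = Ψ_G`. NEW: **`IsSpanningTwoForest E F`** (`|F| = V − 1 ∧ rk F = |F|`;
`isSpanningTwoForest_iff`: a forest with exactly two components on all `V + 1` vertices — Brown's spanning 2-tree);
**`momentumFlow E F p`** (`= Σ_{v ~_F 0} p_v`, the momentum on the root side; the other side carries the opposite flow under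
conservation, `momentumFlow_add_sum_filter_not`); **`secondSymanzikPolynomial E p m ∈ ℝ[x_e]`** = LITERALLY eq. (PsiPhi_slow), momenta
`p : Fin (V+1) → W` in any real normed group `W` (the print: `ℝ^D`), masses `m : Fin N → ℝ`; **`IsMomentumSpanning E p γ`** (all
vertices with `p_v ≠ 0` mutually `γ`-reachable: Brown Def. 1.8 in vertex form — equivalent under momentum conservation, which forces
≥ 2 such vertices when there is one); **`IsMassMomentumSpanning E p m γ`** (`∀ e, m_e ≠ 0 → e ∈ γ`, and momentum-spanning: Brown
Def. 2.6 = Borinsky's combinatorial sentence; the other printed definition `Φ_{G/γ} = 0` is NOT typed — no quotient graphs here);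
**`IsGenericMomenta p`** (no non-empty proper subset of the momentum-carrying vertices sums to zero: eq. (genericmomenta) in vertex
form; `I = ∅`, for which the printed condition is void, is read as excluded; in the Euclidean region `(Σq)² ≠ 0 ⟺ Σq ≠ 0` and
Brown's (genericmassmomenta) / Schultka's second condition is automatic); **`zSecondSymanzik E p m γ = ℓ(γ) + δ_{m.m.}(γ)`** (Theorem
32's `z_{Φ_G}`, BMT23's `z_ℱ`; Schultka's `s_G = z_Ψ + z_Φ`). "Euclidean" is built in: every coefficient `‖p(T₂)‖²`, `m_e²` is
`≥ 0` (`coeff_secondSymanzikPolynomial_nonneg`). The Newton polytope `NP⟦p⟧ = conv{ℓ ∈ supp p}` is the LOCAL NOTATION of the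
companions, copied byte-for-byte.

PROOF ROUTE (disclosed). The prints cite Schultka's induction on the number of edges via Brown's infra-red factorisation (Thm 4.15
from Prop. 4.11 / Cor. 4.12, for the product `ψ_G Φ_G`). We follow instead the Kruskal route of Borinsky's Remark 33 exactly as the
companion does for `Ψ_G`, now for `Φ_G` alone: (0) linear algebra of incidence rows — `u ~_γ v ⟺ 𝟙_u − 𝟙_v ∈ span{rows of γ}`
(Biggs Prop. 4.3; `reachable_iff_single_sub_single_mem_span`), whence "same rank on a nested pair ⇒ same components" and the STRICT
submodularity `rk(A∪B) + rk(A∩B) + 1 ≤ rk A + rk B` when `u ~ v` in `A` and in `B` but not in `A ∩ B` (dimension formula;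
`edgeRank_union_add_inter_add_one_le`); (1) `z_Φ` supermodular for EVERY edge list and all data: `ℓ` supermodular, `δ_{m.m.}`
monotone, and in the only bad case (`A`, `B` m.m., `A ∩ B` not — then the massive edges lie in `A ∩ B` and some external pair is
disconnected there) the loop number is strictly supermodular by (0) — Schultka's Prop. 4.13 argument in rank form; (2) the monomials
of `Φ_G`: exponents `𝟙_{E∖T₂}` (2-forests with `p(T₂) ≠ 0`) and `𝟙_{E∖T₁} + 𝟙_e` (spanning tree, `m_e ≠ 0`), no cancellations
(Schultka's admissible pairs; Brown Lemma 1.12's "all signs … positive"); (3) `supp Φ ⊆ 𝒢_{z_Φ}` facet by facet: `|I ∖ T₂| ≥ ℓ(I)`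
with strict inequality for m.m. `I` (else `I ∩ T₂` would have the components of `I` and join the external vertices inside `T₂`,
contradicting `p(T₂) ≠ 0` under conservation — Brown's proof of Prop. 2.4), and `1_{E∖T₁} + 1_{{e}} ∈ 𝒢_{z_Ψ} + 𝒢_{δ} ⊆ 𝒢_{z_Φ}`
(Lemma 25); (4) every vertex `w^{(σ,z_Φ)} = w^{(σ,ℓ)} + w^{(σ,δ)} = 1_{E∖T_σ} + 1_{{e*}}` (eq. (41) is linear; `T_σ` Kruskal's tree of
`σ`, `e* = σ(k)` the first edge at which the chain `A^σ_k` becomes m.m.) is an exponent: if `e*` is massive it is a mass monomial;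
otherwise `e*` joins two groups of external vertices, so it raises the rank (`e* ∈ T_σ`) and `T_σ ∖ e*` is a spanning 2-forest
separating them (a strict-submodularity count inside the forest `T_σ`), whose flow is non-zero by GENERIC momenta (Brown Lemma
1.12); (5) `conv S = 𝒢_z` for `supp ⊆ S ∋` all vertices (`convexHull_eq_gpPolytope`, Hahn–Banach, companion). Momentum conservation
enters (3), genericity enters (4); the trivial-kinematics case (`∅` m.m. ⇒ all momenta and masses vanish ⇒ `Φ_G = 0`, `z_Φ(∅) = 1`,
both sides empty) is treated separately, so the main theorem carries NO non-triviality hypothesis.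

PROVED (0 named facts; 7 definitions with bodies; Mathlib + the companion files only). Part 0 (row spans):
`incidenceRows_row_eq_single_sub_single`, `edgeRank_eq_finrank_span_incidenceRows`, `span_incidenceRows_mono`, `span_incidenceRows_union`
(private plumbing: `range_incidenceRows_mono`, `range_incidenceRows_union`),
`single_sub_single_mem_span_of_reachable`, `dotProduct_eq_zero_of_mem_span`, `reachable_of_single_sub_single_mem_span`,
**`reachable_iff_single_sub_single_mem_span`**, `reachable_iff_reachable_of_span_eq`, **`reachable_iff_reachable_of_subset_of_edgeRank_eq`**,
**`edgeRank_union_add_inter_add_one_le`**. Part 2 (API): `edgeGraph_mono`, `edgeRank_eq_card_of_subset`, **`isSpanningTwoForest_iff`**,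
`IsSpanningTwoForest.natCard_connectedComponent`, `IsSpanningTwoForest.reachable_iff_not_reachable`,
**`IsSpanningTree.isSpanningTwoForest_erase`**, `momentumFlow_add_sum_filter_not`, `IsMomentumSpanning.mono`, `IsMassMomentumSpanning.mono`
(Brown Lemma 6.1 (i)), `isMassMomentumSpanning_univ`, `isMassMomentumSpanning_empty_iff`,
**`not_isMomentumSpanning_of_momentumFlow_ne_zero`**, **`momentumFlow_ne_zero_of_not_isMomentumSpanning`** (Brown Lemma 1.12's mechanism),
`zSecondSymanzik_apply`, `zSecondSymanzik_eq_add`. Part 3: `loopNumber_add_loopNumber_add_one_le`, **`supermodular_zSecondSymanzik`**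
(Schultka Prop. 4.13 / "the supermodular function z_{Φ_G}"), `zSecondSymanzik_empty`, `zSecondSymanzik_univ`. Part 4 (monomials):
**`secondSymanzikPolynomial_eq_sum_monomial`**, **`coeff_secondSymanzikPolynomial`**, `coeff_secondSymanzikPolynomial_nonneg`,
`sq_norm_momentumFlow_le_coeff`, `sq_mass_le_coeff`, `sum_single_compl_mem_support_secondSymanzikPolynomial`,
`sum_single_compl_add_single_mem_support_secondSymanzikPolynomial`, **`exists_of_mem_support_secondSymanzikPolynomial`** (Schultka's
admissible pairs). Part 5 (facets): (private: `natCast_sum_single_eq_setIndicator`, `natCast_sum_single_add_single_eq`, `sum_setIndicator`), `edgeRank_mono`,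
`setIndicator_singleton_mem_gpPolytope`, **`setIndicator_compl_add_mem_gpPolytope`**, **`setIndicator_compl_twoForest_mem_gpPolytope`**,
**`natCast_mem_gpPolytope_of_mem_support`** (`NP_Φ ⊆ P[z_Φ]`). Part 6 (vertices): `chainSet_mono`, **`exists_ftVertex_mmIndicator_eq`**
(`w^{(σ,δ)} = 1_{{σ(k)}}`), **`exists_mem_support_natCast_eq_ftVertex`** (`P[z_Φ] ⊆ NP_Φ` on the vertices). Part 7:
`Borinsky2020.gpPolytope_eq_empty_of_pos`, `forall_eq_zero_of_isMassMomentumSpanning_empty`,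
`secondSymanzikPolynomial_eq_zero_of_forall_eq_zero`, **`newtonPolytope_secondSymanzikPolynomial_eq_gpPolytope`** (THEOREM 32 / BMT23 THEOREM
3.4: `NP_{Φ_G} = 𝒢_{z_Φ}`), `exists_supermodular_newtonPolytope_secondSymanzikPolynomial_eq` ("is a generalized permutahedron"),
**`secondSymanzikPolynomial_eq_zero_iff`** (Brown Lemma 1.13, Euclidean), `not_isMassMomentumSpanning_empty_of_ne_zero`. Part 8 (tropical
reading): **`faceValue_secondSymanzikPolynomial_eq_gpSupport`**, `trop_secondSymanzikPolynomial_exp`,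
**`trop_secondSymanzikPolynomial_eq_prod_rpow_ftVertex`** (`Φ^tr|_{Exp C_σ} = x^{w^{(σ,z_Φ)}}`),
**`trop_secondSymanzikPolynomial_eq_prod_compl_mul`** (`= (Π_{e∉T_σ} x_e) · x_{σ(k)}`, the Hepp-sector monomial of `Φ_G` from graph data),
`sum_chainSet_ftVertex_zSecondSymanzik` (Hepp's sector degrees `ℓ(A^σ_k) + δ_{m.m.}(A^σ_k)`). Part 9 (§7.2):
`smul_newtonPolytope_secondSymanzikPolynomial_eq_gpPolytope`, **`scriptB_eq_gpPolytope`** (`ℬ = ½D NP_Ψ + ω(G) NP_Φ = 𝒢_{(D/2)ℓ + ω z_Φ}`),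
**`scriptA_eq_gpPolytope`** (`𝒜 = Σ_e ν_e NP_{p_e} + ω(G) NP_Ψ = 𝒢_{z_ν + ω ℓ}`), **`scriptA_sub_scriptB_apply`** (`r_G(γ) = graphSdc E D ν γ
− ω(G) δ_{m.m.}(γ)`).

NOT typed / does NOT say: the other printed definition of m.m. (`Φ_{G/γ} = 0`, `Ξ_{G/γ} = 0`) and its equivalence with the
combinatorial one (Brown eq. (2.3), Lemma 1.13 for quotients) — no quotient graphs in the tree; Brown's infra-red / ultraviolet
factorisations of `Φ` and `Ξ` themselves (Prop. 2.4, Theorem 2.7; Schultka Prop. 4.11 (3)–(5), Cor. 4.12) — only their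
CONSEQUENCE Theorem 32 is proved, by a different route; BMT23 Theorem 3.6 (Minkowski / pseudo-Euclidean regimes with generic
kinematics: complex or indefinite `(q^{T_1})²` — here `W` is a real normed group and every coefficient is `≥ 0`), Conjecture 3.7
(Euclidean EXCEPTIONAL kinematics, e.g. on-shell or zero-momentum-transfer configurations — NOT covered: `IsGenericMomenta` is a
hypothesis of every polytope EQUALITY below, and Brown's Example 2.5 shows the facet function can change without it; only the
INCLUSION of Theorem 3.9, `newtonPolytope_secondSymanzikPolynomial_subset_gpPolytope`, is proved for all conserved momenta — appended
g30 together with the numbering correction), §2.3 /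
Assumption 3.2 (the `iε`-deformed `𝒱` polynomial); Schultka's Theorem 4.15 as printed for the PRODUCT polytope `P_G = NP(ψ_G Φ_G) = 𝒢_{s_G}`
(it follows from the two summands by Lemma 25, `gpPolytope_add`, but is not restated); the 1PI / dimension statements (Schultka
Prop. 4.17); anything about sector decomposition algorithms, samplers, words, signed or subtracted integrands, or variance.
(Filed by the pub-qed TROPICAL literature seat `pub-qed-trop-lit` gen 30; `tropical/lit/SOURCES.md` A34; numbering erratum + Theorem 3.9: A37.)
-/

noncomputable section

open scoped Pointwise

namespace Literature.MathematicalPhysics.QuantumFieldTheory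

open Finset Matrix

variable {N V : ℕ} (E : Fin N → Fin (V + 1) × Fin (V + 1))

/-! ## Part 0 — incidence rows and reachability: `u ~_γ v ⟺ 𝟙_u − 𝟙_v ∈ span{rows of γ}` -/

section RowSpan

/-- A row of the oriented incidence matrix is the difference of the unit vectors of its endpoints:
`row_e = 𝟙_{s(e)} − 𝟙_{t(e)}` (Biggs Def. 4.2). [cite: Biggs1974, Ch. 4 Def. 4.2] -/
theorem incidenceRows_row_eq_single_sub_single (γ : Finset (Fin N)) (q : {e // e ∈ γ}) :
    incidenceRows ℚ E γ q = Pi.single (E q.1).1 (1 : ℚ) - Pi.single (E q.1).2 1 := by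
  funext v
  simp only [incidenceRows_apply, Pi.sub_apply, Pi.single_apply, @eq_comm _ v]

/-- The rows of `γ ⊆ γ'` are rows of `γ'`. Plumbing. [folklore] -/
private theorem range_incidenceRows_mono {A B : Finset (Fin N)} (h : A ⊆ B) :
    Set.range (incidenceRows ℚ E A) ⊆ Set.range (incidenceRows ℚ E B) := by
  rintro _ ⟨⟨e, he⟩, rfl⟩
  exact ⟨⟨e, h he⟩, rfl⟩

/-- The rows of `A ∪ B` are the rows of `A` together with the rows of `B`. Plumbing. [folklore] -/
private theorem range_incidenceRows_union (A B : Finset (Fin N)) :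
    Set.range (incidenceRows ℚ E (A ∪ B)) =
      Set.range (incidenceRows ℚ E A) ∪ Set.range (incidenceRows ℚ E B) := by
  refine Set.Subset.antisymm ?_ (Set.union_subset (range_incidenceRows_mono E subset_union_left)
    (range_incidenceRows_mono E subset_union_right))
  rintro _ ⟨⟨e, he⟩, rfl⟩
  rcases Finset.mem_union.1 he with h | h
  · exact Or.inl ⟨⟨e, h⟩, rfl⟩
  · exact Or.inr ⟨⟨e, h⟩, rfl⟩

/-- **Rank = dimension of the row span** for the tree's `edgeRank`: `edgeRank E γ = dim span{row_e : e ∈ γ}` with the FULL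
oriented incidence rows on all `V + 1` vertices (deleting the root column does not change the rank,
`rank_reducedRows_eq_rank_incidenceRows`). [cite: Biggs1974, Ch. 4 Prop. 4.3 with Ch. 5 Prop. 5.4] -/
theorem edgeRank_eq_finrank_span_incidenceRows (γ : Finset (Fin N)) :
    edgeRank E γ = Module.finrank ℚ (Submodule.span ℚ (Set.range (incidenceRows ℚ E γ))) := by
  rw [edgeRank_eq_rank_reducedRows, rank_reducedRows_eq_rank_incidenceRows, rank_eq_finrank_span_row]
  rfl

/-- The row space of the incidence rows is monotone in the edge set (Biggs's incidence matrix of the subgraph `⟨Q⟩` of an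
edge set `Q` consists of the rows `Q` of `D`). [cite: Biggs1974, Ch. 4 Prop. 4.3 and text before Thm 4.5 (the subgraph ⟨Q⟩ of an edge set Q)] -/
theorem span_incidenceRows_mono {A B : Finset (Fin N)} (h : A ⊆ B) :
    Submodule.span ℚ (Set.range (incidenceRows ℚ E A)) ≤ Submodule.span ℚ (Set.range (incidenceRows ℚ E B)) :=
  Submodule.span_mono (range_incidenceRows_mono E h)

/-- The row space of the incidence rows of `A ∪ B` is the sum of the row spaces of `A` and of `B` (the rows of `⟨A ∪ B⟩` are the
rows of `⟨A⟩` and of `⟨B⟩`). [cite: Biggs1974, Ch. 4 Prop. 4.3 and text before Thm 4.5 (the subgraph ⟨Q⟩ of an edge set Q)] -/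
theorem span_incidenceRows_union (A B : Finset (Fin N)) :
    Submodule.span ℚ (Set.range (incidenceRows ℚ E (A ∪ B))) =
      Submodule.span ℚ (Set.range (incidenceRows ℚ E A)) ⊔ Submodule.span ℚ (Set.range (incidenceRows ℚ E B)) := by
  rw [range_incidenceRows_union, Submodule.span_union]

/-- **Reachable ⇒ in the row span**: if `u ~ v` in the graph spanned by `γ`, then `𝟙_u − 𝟙_v` is a sum of `±row_e`, `e ∈ γ`
(telescoping along a walk; Biggs Ch. 5: the rows of a path sum to `𝟙_u − 𝟙_v`). [cite: Biggs1974, Ch. 4 Prop. 4.3 (proof) and Ch. 5 Prop. 5.4 (proof)] -/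
theorem single_sub_single_mem_span_of_reachable {γ : Finset (Fin N)} {u v : Fin (V + 1)}
    (h : (edgeGraph E γ).Reachable u v) :
    (Pi.single u (1 : ℚ) - Pi.single v 1) ∈ Submodule.span ℚ (Set.range (incidenceRows ℚ E γ)) := by
  obtain ⟨p⟩ := h
  induction p with
  | nil => simp
  | @cons a b c hab _ ih =>
    have hab' : (Pi.single a (1 : ℚ) - Pi.single b 1) ∈ Submodule.span ℚ (Set.range (incidenceRows ℚ E γ)) := by
      obtain ⟨-, ⟨e, he, hE⟩ | ⟨e, he, hE⟩⟩ := (edgeGraph_adj E γ a b).1 hab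
      · have hrow := incidenceRows_row_eq_single_sub_single E γ ⟨e, he⟩
        rw [hE] at hrow
        rw [← hrow]
        exact Submodule.subset_span ⟨⟨e, he⟩, rfl⟩
      · have hrow := incidenceRows_row_eq_single_sub_single E γ ⟨e, he⟩
        rw [hE] at hrow
        have : Pi.single a (1 : ℚ) - Pi.single b 1 = -(incidenceRows ℚ E γ ⟨e, he⟩) := by
          rw [hrow]; abel
        rw [this]
        exact Submodule.neg_mem _ (Submodule.subset_span ⟨⟨e, he⟩, rfl⟩)
    have hsum : (Pi.single a (1 : ℚ) - Pi.single c 1 : Fin (V + 1) → ℚ) =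
        (Pi.single a (1 : ℚ) - Pi.single b 1) + (Pi.single b (1 : ℚ) - Pi.single c 1) := by abel
    rw [hsum]
    exact Submodule.add_mem _ hab' ih

/-- A vertex function constant across every edge of `γ` is orthogonal to the row span of `γ`
(`row_e · x = x(s e) − x(t e) = 0`; Biggs, proof of Prop. 4.3). [cite: Biggs1974, Ch. 4 Prop. 4.3 (proof)] -/
theorem dotProduct_eq_zero_of_mem_span {γ : Finset (Fin N)} {x : Fin (V + 1) → ℚ}
    (hx : ∀ e ∈ γ, x (E e).1 = x (E e).2) {r : Fin (V + 1) → ℚ}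
    (hr : r ∈ Submodule.span ℚ (Set.range (incidenceRows ℚ E γ))) : r ⬝ᵥ x = 0 := by
  induction hr using Submodule.span_induction with
  | mem r hr =>
    obtain ⟨⟨e, he⟩, rfl⟩ := hr
    rw [incidenceRows_row_eq_single_sub_single, sub_dotProduct, single_dotProduct, single_dotProduct,
      one_mul, one_mul, sub_eq_zero]
    exact hx e he
  | zero => exact zero_dotProduct x
  | add r s _ _ hr hs => rw [add_dotProduct, hr, hs, add_zero]
  | smul c r _ hr => rw [smul_dotProduct, hr, smul_zero]

/-- **In the row span ⇒ reachable**: if `𝟙_u − 𝟙_v ∈ span{row_e : e ∈ γ}` then `u ~ v` in the graph spanned by `γ` (pair the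
relation with the indicator function of the component of `u`, which is constant across every edge of `γ`). Together with the
previous theorem: the row space of the incidence rows of `γ` "sees" exactly the connected components (Biggs Prop. 4.3).
[cite: Biggs1974, Ch. 4 Prop. 4.3 (proof)] -/
theorem reachable_of_single_sub_single_mem_span {γ : Finset (Fin N)} {u v : Fin (V + 1)}
    (h : (Pi.single u (1 : ℚ) - Pi.single v 1) ∈ Submodule.span ℚ (Set.range (incidenceRows ℚ E γ))) :
    (edgeGraph E γ).Reachable u v := by
  classical
  set x : Fin (V + 1) → ℚ := fun w => if (edgeGraph E γ).Reachable u w then 1 else 0 with hxdef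
  have hx : ∀ e ∈ γ, x (E e).1 = x (E e).2 := by
    intro e he
    have hc := connectedComponentMk_fst_eq E he
    rw [SimpleGraph.ConnectedComponent.eq] at hc
    simp only [hxdef]
    by_cases h1 : (edgeGraph E γ).Reachable u (E e).1
    · rw [if_pos h1, if_pos (h1.trans hc)]
    · rw [if_neg h1, if_neg fun h2 => h1 (h2.trans hc.symm)]
  have h0 := dotProduct_eq_zero_of_mem_span E hx h
  rw [sub_dotProduct, single_dotProduct, single_dotProduct, one_mul, one_mul, sub_eq_zero] at h0
  simp only [hxdef, if_pos (SimpleGraph.Reachable.refl u)] at h0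
  by_contra hne
  rw [if_neg hne] at h0
  exact one_ne_zero h0

/-- **Reachability is read off the row span**: `u ~_γ v ⟺ 𝟙_u − 𝟙_v ∈ span{row_e : e ∈ γ}`. [cite: Biggs1974, Ch. 4 Prop. 4.3] -/
theorem reachable_iff_single_sub_single_mem_span (γ : Finset (Fin N)) (u v : Fin (V + 1)) :
    (edgeGraph E γ).Reachable u v ↔
      (Pi.single u (1 : ℚ) - Pi.single v 1) ∈ Submodule.span ℚ (Set.range (incidenceRows ℚ E γ)) :=
  ⟨single_sub_single_mem_span_of_reachable E, reachable_of_single_sub_single_mem_span E⟩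

/-- Equal row spans ⇒ equal reachability. [cite: Biggs1974, Ch. 4 Prop. 4.3] -/
theorem reachable_iff_reachable_of_span_eq {A B : Finset (Fin N)}
    (h : Submodule.span ℚ (Set.range (incidenceRows ℚ E A)) = Submodule.span ℚ (Set.range (incidenceRows ℚ E B)))
    (u v : Fin (V + 1)) : (edgeGraph E A).Reachable u v ↔ (edgeGraph E B).Reachable u v := by
  rw [reachable_iff_single_sub_single_mem_span, reachable_iff_single_sub_single_mem_span, h]

/-- **Same rank on a nested pair ⇒ same components**: if `A ⊆ B` and `rk A = rk B` then `u ~_A v ⟺ u ~_B v` (the row spans are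
nested of equal dimension, hence equal). This is the rank form of "the edges of `B ∖ A` close cycles only" (Kruskal).
[cite: Biggs1974, Ch. 4 Prop. 4.3; Panzer2022, §2.2 Lemma 2.8] -/
theorem reachable_iff_reachable_of_subset_of_edgeRank_eq {A B : Finset (Fin N)} (hAB : A ⊆ B)
    (hrk : edgeRank E A = edgeRank E B) (u v : Fin (V + 1)) :
    (edgeGraph E A).Reachable u v ↔ (edgeGraph E B).Reachable u v := by
  refine reachable_iff_reachable_of_span_eq E ?_ u v
  refine Submodule.eq_of_le_of_finrank_eq (span_incidenceRows_mono E hAB) ?_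
  rw [← edgeRank_eq_finrank_span_incidenceRows, ← edgeRank_eq_finrank_span_incidenceRows, hrk]

/-- **Strict submodularity of the rank across a disconnection**: if `u ~ v` in `A` and in `B` but NOT in `A ∩ B`, then
`rk(A ∪ B) + rk(A ∩ B) + 1 ≤ rk A + rk B` (the relation `𝟙_u − 𝟙_v` lies in both row spans but not in that of `A ∩ B`, so
`span(A ∩ B)` is a PROPER subspace of `span A ⊓ span B`; dimension formula). The graphic-matroid step behind the supermodularity
of `z_Φ = ℓ + δ_{m.m.}` below. [cite: Biggs1974, Ch. 4 Prop. 4.3; Schultka2018, Theorem 4.15 (s_G supermodular)] -/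
theorem edgeRank_union_add_inter_add_one_le {A B : Finset (Fin N)} {u v : Fin (V + 1)}
    (hA : (edgeGraph E A).Reachable u v) (hB : (edgeGraph E B).Reachable u v)
    (hAB : ¬ (edgeGraph E (A ∩ B)).Reachable u v) :
    edgeRank E (A ∪ B) + edgeRank E (A ∩ B) + 1 ≤ edgeRank E A + edgeRank E B := by
  set WA := Submodule.span ℚ (Set.range (incidenceRows ℚ E A)) with hWA
  set WB := Submodule.span ℚ (Set.range (incidenceRows ℚ E B)) with hWB
  set WI := Submodule.span ℚ (Set.range (incidenceRows ℚ E (A ∩ B))) with hWI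
  have hdim := Submodule.finrank_sup_add_finrank_inf_eq WA WB
  have hlt : WI < WA ⊓ WB := by
    refine lt_of_le_of_ne (le_inf (span_incidenceRows_mono E inter_subset_left)
      (span_incidenceRows_mono E inter_subset_right)) fun heq => hAB ?_
    rw [reachable_iff_single_sub_single_mem_span, ← hWI, heq]
    exact ⟨single_sub_single_mem_span_of_reachable E hA, single_sub_single_mem_span_of_reachable E hB⟩
  have hlt' := Submodule.finrank_lt_finrank_of_lt hlt
  rw [edgeRank_eq_finrank_span_incidenceRows, edgeRank_eq_finrank_span_incidenceRows,
    edgeRank_eq_finrank_span_incidenceRows, edgeRank_eq_finrank_span_incidenceRows,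
    span_incidenceRows_union, ← hWA, ← hWB, ← hWI]
  omega

end RowSpan

/-! ## Part 1 — spanning 2-forests, momentum flow, the second Symanzik polynomial `Φ_G`, m.m. subgraphs, generic momenta -/

section Definitions

variable {W : Type*} [NormedAddCommGroup W]

/-- **Spanning 2-forest** `T₂` of the edge list `E` on the `V + 1` vertices ("spanning forests with two connected components",
Borinsky eq. (PsiPhi_slow); Brown Def. 1.2: "A spanning k-tree of G is a subgraph T = T_1 ∪ … ∪ T_k … which has exactly k
components T_i such that T_i is a tree and V_T = V_G", k = 2), in the tree's RANK FORM (as `HeppBound.IsSpanningTree`): `V − 1`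
edges whose incidence rows are independent (a forest), equivalently a forest with exactly two components on all vertices
(`isSpanningTwoForest_iff`). [cite: Borinsky2020, §7.1 eq. (PsiPhi_slow) (tropical.tex l.1185–1187); Brown2017, Def. 1.2] -/
def IsSpanningTwoForest (F : Finset (Fin N)) : Prop :=
  F.card + 1 = V ∧ edgeRank E F = F.card

open scoped Classical in
/-- **The momentum flowing between the two components of a spanning 2-forest** ("p(T₂) is the total momentum flowing between
the two components of the 2-forest T₂", Borinsky; Brown: "q^{T_1} = Σ_{i∈E^ext_{T_1}} q_i is the total momentum entering T_1. It
equals −q^{T_2} by momentum conservation"): the sum of the incoming vertex momenta `p^{(v)} ∈ W` over the component of the root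
vertex `0` in the graph spanned by `F` (for a 2-forest this is one of its two components; the other choice changes the sign only,
`momentumFlow_add_sum_filter_not`). Momenta live in any real normed group `W` (the print: `ℝ^D`).
[cite: Borinsky2020, §7.1 after eq. (PsiPhi_slow) (tropical.tex l.1187); Brown2017, §1.2 eq. (phidefn)] -/
def momentumFlow (F : Finset (Fin N)) (p : Fin (V + 1) → W) : W :=
  ∑ v ∈ univ.filter (fun v => (edgeGraph E F).Reachable 0 v), p v

open scoped Classical in
/-- **The second Symanzik polynomial with masses, Euclidean kinematics** — Borinsky's `Φ_G`, eq. (PsiPhi_slow): "Φ_G(x) = Σ_{T₂}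
‖p(T₂)‖² Π_{e∉T₂} x_e + Ψ_G Σ_e x_e m_e²" (= Brown's `Ξ_G(q,m) = Φ_G(q) + (Σ_e m_e² α_e) Ψ_G`, Def. 1.4, with `Φ_G(q) = Σ_{T_1∪T_2}
(q^{T_1})² Π_{e∉T_1∪T_2} α_e`; = BMT23's `ℱ` in the Euclidean regime), as a formal polynomial in `ℝ[x_e : e ∈ E]`: incoming momenta
`p : Fin (V+1) → W` at the vertices, masses `m : Fin N → ℝ` on the edges, `Ψ_E = kirchhoffPolynomial ℝ E`.
[cite: Borinsky2020, §7.1 eq. (PsiPhi_slow) (tropical.tex l.1185–1187); Brown2017, Def. 1.3–1.4 (eq. (phidefn), (Xidefn)); BorinskyMunchTellander2023, §2 eq. (polyUF)] -/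
def secondSymanzikPolynomial (p : Fin (V + 1) → W) (m : Fin N → ℝ) : MvPolynomial (Fin N) ℝ :=
  (∑ F ∈ univ.filter (IsSpanningTwoForest E), ‖momentumFlow E F p‖ ^ 2 • ∏ e ∈ Fᶜ, MvPolynomial.X e) +
    kirchhoffPolynomial ℝ E * ∑ e, m e ^ 2 • MvPolynomial.X e

/-- **Momentum-spanning** edge set (Brown Def. 1.8: "γ ⊂ E_G is momentum-spanning if ∂E^ext_G ⊂ V_γ, and the vertices E^ext_G lie
in a single connected component of the graph (V_γ, E_γ)"; Borinsky: "one connected component which connects all vertices with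
non-zero incoming momentum"): all vertices with non-zero incoming momentum are mutually reachable along edges of `γ`.
[cite: Brown2017, Def. 1.8; Borinsky2020, §7.1 (tropical.tex l.1195)] -/
def IsMomentumSpanning (p : Fin (V + 1) → W) (γ : Finset (Fin N)) : Prop :=
  ∀ u v : Fin (V + 1), p u ≠ 0 → p v ≠ 0 → (edgeGraph E γ).Reachable u v

/-- **Mass-momentum spanning (m.m.)** edge set (Brown Def. 2.6: "γ ⊂ G is mass-spanning if it contains all massive edges of G … γ
is mass-momentum spanning (or simply m.m. for short) if it is both mass and momentum-spanning"; Borinsky: "subgraphs that contain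
all massive edges and one connected component which connects all vertices with non-zero incoming momentum"). The print's other
definition `Φ_{G/γ} = 0` (equivalent under generic kinematics, Brown eq. (2.3)/Lemma 1.13) is not typed: the tree has no quotient
graphs. [cite: Brown2017, Def. 2.6; Borinsky2020, §7.1 (tropical.tex l.1195); BorinskyMunchTellander2023, §3.3 (main.tex l.733–736)] -/
def IsMassMomentumSpanning (p : Fin (V + 1) → W) (m : Fin N → ℝ) (γ : Finset (Fin N)) : Prop :=
  (∀ e, m e ≠ 0 → e ∈ γ) ∧ IsMomentumSpanning E p γ

/-- **Generic (non-exceptional) momenta** (Brown eq. (genericmomenta): "(Σ_{i∈I} q_i)² ≠ 0 for all I ⊊ E^ext_G"; Borinsky: "no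
non-trivial combination of the external momenta … adds up to 0"), in vertex form after Brown's equivalence "if a vertex has several
incoming momenta q_1,…,q_n we can replace it with a single incoming momentum q_1 + ⋯ + q_n" and "external legs which would … have
zero incoming momentum will simply be omitted": no NON-EMPTY PROPER subset of the vertices carrying non-zero momentum has total
momentum zero (for `I = ∅` the printed condition is void and is read as excluded; in the Euclidean region `(Σq)² ≠ 0 ⟺ Σq ≠ 0`,
and Brown's second condition (genericmassmomenta) `(Σ_{i∈I} q_i)² + m_e² ≠ 0` is then automatic for `m_e ≠ 0`).
[cite: Brown2017, §1.6 eq. (genericmomenta), §1.7 Def. 1.15; Borinsky2020, after Theorem 32 (tropical.tex l.1203–1204)] -/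
def IsGenericMomenta {ι : Type*} (p : ι → W) : Prop :=
  ∀ I : Finset ι, I.Nonempty → (∀ v ∈ I, p v ≠ 0) → (∃ v ∉ I, p v ≠ 0) → ∑ v ∈ I, p v ≠ 0

open scoped Classical in
/-- **Borinsky's boolean function `z_{Φ_G}`** (Theorem 32: "z_{Φ_G}(γ) = ℓ(γ) + 1 if γ is m.m. in G, ℓ(γ) else"; BMT23 Theorem 3.5:
"z_ℱ(γ) = L_γ + 1 if γ is mass-momentum spanning and z_ℱ(γ) = L_γ otherwise"; Schultka's `s_G`), with `ℓ = loopNumber E`.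
[cite: Borinsky2020, Theorem 32 (tropical.tex l.1199–1201); BorinskyMunchTellander2023, Theorem 3.5 (main.tex l.740–748); Schultka2018, Theorem 4.15] -/
def zSecondSymanzik (p : Fin (V + 1) → W) (m : Fin N → ℝ) (γ : Finset (Fin N)) : ℝ :=
  loopNumber E γ + if IsMassMomentumSpanning E p m γ then 1 else 0

end Definitions

/-! ## Part 2 — elementary API: 2-forests, components, momentum flow, m.m. -/

section API

variable {E}
variable {W : Type*} [NormedAddCommGroup W]

/-- The graph spanned by a larger edge set is larger: `⟨A⟩ ≤ ⟨B⟩` for `A ⊆ B` (Biggs's subgraph `⟨Q⟩` of an edge set).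
[cite: Biggs1974, Ch. 4 before Thm 4.5 (the subgraph ⟨Q⟩ of an edge set Q)] -/
theorem edgeGraph_mono {A B : Finset (Fin N)} (h : A ⊆ B) : edgeGraph E A ≤ edgeGraph E B := by
  intro u v huv
  rw [edgeGraph_adj] at huv ⊢
  obtain ⟨hne, ⟨e, he, hE⟩ | ⟨e, he, hE⟩⟩ := huv
  · exact ⟨hne, Or.inl ⟨e, h he, hE⟩⟩
  · exact ⟨hne, Or.inr ⟨e, h he, hE⟩⟩

/-- Independence is hereditary: a subset of a forest is a forest (`rk S = |S|` for `S ⊆ T` with `rk T = |T|`; Oxley §1.1).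
[cite: Oxley2011, §1.1 p. 11 (independent sets of M(G))] -/
theorem edgeRank_eq_card_of_subset {S T : Finset (Fin N)} (hT : edgeRank E T = T.card) (hST : S ⊆ T) :
    edgeRank E S = S.card := by
  have hI : (cycleMatroid E).Indep (T : Set (Fin N)) := (indep_cycleMatroid_iff_edgeRank E T).2 hT
  exact (indep_cycleMatroid_iff_edgeRank E S).1 (hI.subset (Finset.coe_subset.2 hST))

/-- **Rank form = printed form for spanning 2-forests**: `IsSpanningTwoForest E F` iff the incidence rows of `F` are independent
(a forest) and the graph spanned by `F` on all `V + 1` vertices has exactly two connected components (Brown Def. 1.2, k = 2), by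
Kirchhoff's rank theorem `rk + #components = V + 1`. [cite: Brown2017, Def. 1.2; Biggs1974, Ch. 4 Prop. 4.3] -/
theorem isSpanningTwoForest_iff (F : Finset (Fin N)) :
    IsSpanningTwoForest E F ↔ edgeRank E F = F.card ∧ Nat.card (edgeGraph E F).ConnectedComponent = 2 := by
  have h := edgeRank_add_natCard_connectedComponent E F
  unfold IsSpanningTwoForest
  constructor
  · rintro ⟨h1, h2⟩; exact ⟨h2, by omega⟩
  · rintro ⟨h1, h2⟩; exact ⟨by omega, h1⟩

/-- A spanning 2-forest spans exactly two components. [cite: Brown2017, Def. 1.2] -/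
theorem IsSpanningTwoForest.natCard_connectedComponent {F : Finset (Fin N)} (hF : IsSpanningTwoForest E F) :
    Nat.card (edgeGraph E F).ConnectedComponent = 2 :=
  ((isSpanningTwoForest_iff F).1 hF).2

/-- In a spanning 2-forest two non-joined vertices `a ≁ b` represent the two components: every vertex is joined to exactly one of
them. [cite: Brown2017, Def. 1.2 (k = 2)] -/
theorem IsSpanningTwoForest.reachable_iff_not_reachable {F : Finset (Fin N)} (hF : IsSpanningTwoForest E F)
    {a b : Fin (V + 1)} (hab : ¬ (edgeGraph E F).Reachable a b) (w : Fin (V + 1)) :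
    (edgeGraph E F).Reachable a w ↔ ¬ (edgeGraph E F).Reachable b w := by
  have h2 := hF.natCard_connectedComponent
  rw [Nat.card_eq_two_iff' ((edgeGraph E F).connectedComponentMk a)] at h2
  obtain ⟨y, hy, huniq⟩ := h2
  have hb : (edgeGraph E F).connectedComponentMk b = y :=
    huniq _ fun h => hab (SimpleGraph.ConnectedComponent.eq.1 h).symm
  constructor
  · intro haw hbw
    exact hab (haw.trans hbw.symm)
  · intro hbw
    by_contra haw
    have hw : (edgeGraph E F).connectedComponentMk w = y :=
      huniq _ fun h => haw (SimpleGraph.ConnectedComponent.eq.1 h).symm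
    exact hbw (SimpleGraph.ConnectedComponent.eq.1 (hb.trans hw.symm))

/-- **Deleting an edge of a spanning tree leaves a spanning 2-forest** (Brown, proof of Lemma 1.12: "Delete any edge e' in this
path to obtain a spanning 2-tree T∖e' = T_1 ∪ T_2"). [cite: Brown2017, Lemma 1.12 (proof)] -/
theorem IsSpanningTree.isSpanningTwoForest_erase {T : Finset (Fin N)} (hT : IsSpanningTree E T) {e : Fin N} (he : e ∈ T) :
    IsSpanningTwoForest E (T.erase e) := by
  refine ⟨?_, edgeRank_eq_card_of_subset (hT.2.trans hT.1.symm) (Finset.erase_subset e T)⟩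
  rw [Finset.card_erase_of_mem he, hT.1]
  exact Nat.sub_add_cancel (Finset.card_pos.2 ⟨e, he⟩ |>.trans_le (hT.1.le) |> Nat.succ_le_of_lt)

/-- The momentum flow of the root component plus that of its complement is the total incoming momentum (so under momentum
conservation the two components of a 2-forest carry opposite flows: "It equals −q^{T_2} by momentum conservation").
[cite: Brown2017, §1.2 after eq. (phidefn)] -/
theorem momentumFlow_add_sum_filter_not (F : Finset (Fin N)) (p : Fin (V + 1) → W) :
    momentumFlow E F p + ∑ v ∈ univ.filter (fun v => ¬ (edgeGraph E F).Reachable 0 v), p v = ∑ v, p v := by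
  classical
  unfold momentumFlow
  exact Finset.sum_filter_add_sum_filter_not _ _ _

/-- Momentum-spanning is monotone in the edge set (Brown Lemma 6.1 (i): "if γ is mass-momentum spanning in G, then so too is Γ ⊇ γ").
[cite: Brown2017, Lemma 6.1 (i) (chunk p0026:L47)] -/
theorem IsMomentumSpanning.mono {p : Fin (V + 1) → W} {A B : Finset (Fin N)} (h : IsMomentumSpanning E p A) (hAB : A ⊆ B) :
    IsMomentumSpanning E p B :=
  fun u v hu hv => (h u v hu hv).mono (edgeGraph_mono hAB)

/-- M.m. is monotone in the edge set (Brown Lemma 6.1 (i)). [cite: Brown2017, Lemma 6.1 (i) (chunk p0026:L47)] -/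
theorem IsMassMomentumSpanning.mono {p : Fin (V + 1) → W} {m : Fin N → ℝ} {A B : Finset (Fin N)}
    (h : IsMassMomentumSpanning E p m A) (hAB : A ⊆ B) : IsMassMomentumSpanning E p m B :=
  ⟨fun e he => hAB (h.1 e he), h.2.mono hAB⟩

/-- **The whole graph is m.m.** when the edge list is connected ("γ is momentum-spanning iff G/γ is equivalent to a graph with no
external momenta": `G/G` is a point). [cite: Brown2017, §1.4 after Def. 1.8; Borinsky2020, §7.1 (Φ_{G/γ} = 0 for γ = G)] -/
theorem isMassMomentumSpanning_univ (hconn : IsConnectedEdgeList E) (p : Fin (V + 1) → W) (m : Fin N → ℝ) :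
    IsMassMomentumSpanning E p m univ :=
  ⟨fun e _ => Finset.mem_univ e, fun u v _ _ => ((isConnectedEdgeList_iff_connected E).1 hconn).preconnected u v⟩

/-- **The empty edge set is m.m. iff the kinematics are trivial on it**: no massive edge and at most one vertex with non-zero
momentum (in the graph with no edges only `u = u` is reachable). [cite: Brown2017, Def. 1.8 and Def. 2.6] -/
theorem isMassMomentumSpanning_empty_iff (p : Fin (V + 1) → W) (m : Fin N → ℝ) :
    IsMassMomentumSpanning E p m ∅ ↔ (∀ e, m e = 0) ∧ ∀ u v, p u ≠ 0 → p v ≠ 0 → u = v := by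
  have hbot : edgeGraph E (∅ : Finset (Fin N)) = ⊥ := by
    ext u v
    simp [edgeGraph_adj]
  unfold IsMassMomentumSpanning IsMomentumSpanning
  rw [hbot]
  simp only [SimpleGraph.reachable_bot, Finset.notMem_empty, imp_false, not_not]

/-- **A non-zero flow separates the external vertices**: if `p(T₂) ≠ 0` and the momenta are conserved, `T₂` is NOT momentum-spanning
— both sides of the 2-forest carry a vertex with non-zero momentum (Brown, proof of Prop. 2.4: "each component T_i intersects γ'
non-trivially (otherwise … q^{T_i} = 0 because γ' is momentum-spanning)"). [cite: Brown2017, Prop. 2.4 (proof, chunk p0013:L1–L4)] -/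
theorem not_isMomentumSpanning_of_momentumFlow_ne_zero {F : Finset (Fin N)} {p : Fin (V + 1) → W}
    (hcons : ∑ v, p v = 0) (hF : momentumFlow E F p ≠ 0) : ¬ IsMomentumSpanning E p F := by
  classical
  intro hms
  obtain ⟨a, ha, hpa⟩ := Finset.exists_ne_zero_of_sum_ne_zero hF
  have hsum := momentumFlow_add_sum_filter_not F p (E := E)
  rw [hcons, add_eq_zero_iff_eq_neg] at hsum
  have hF' : ∑ v ∈ univ.filter (fun v => ¬ (edgeGraph E F).Reachable 0 v), p v ≠ 0 := by
    intro h0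
    rw [h0, neg_zero] at hsum
    exact hF hsum
  obtain ⟨b, hb, hpb⟩ := Finset.exists_ne_zero_of_sum_ne_zero hF'
  rw [Finset.mem_filter] at ha hb
  exact hb.2 (ha.2.trans (hms a b hpa hpb))

/-- **Generic momenta make every separating 2-forest contribute**: if `T₂` is a spanning 2-forest that is not momentum-spanning,
then under generic momenta `p(T₂) ≠ 0` — the external vertices on the root side form a non-empty proper subset `I` of the
momentum-carrying vertices, and `p(T₂) = Σ_{v∈I} p_v` (Brown, proof of Lemma 1.12: "It contributes a non-zero monomial
(q^{T_1})² Π α_e … by (genericmomenta)"). [cite: Brown2017, Lemma 1.12 (proof); Borinsky2020, Theorem 32 (non-exceptional kinematics)] -/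
theorem momentumFlow_ne_zero_of_not_isMomentumSpanning {F : Finset (Fin N)} (hF : IsSpanningTwoForest E F)
    {p : Fin (V + 1) → W} (hgen : IsGenericMomenta p) (hms : ¬ IsMomentumSpanning E p F) :
    momentumFlow E F p ≠ 0 := by
  classical
  unfold IsMomentumSpanning at hms
  push Not at hms
  obtain ⟨a, b, hpa, hpb, hab⟩ := hms
  -- one of `a`, `b` lies in the root component, the other does not
  obtain ⟨a, b, hpa, hpb, ha0, hb0⟩ : ∃ a b, p a ≠ 0 ∧ p b ≠ 0 ∧ (edgeGraph E F).Reachable 0 a ∧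
      ¬ (edgeGraph E F).Reachable 0 b := by
    by_cases ha : (edgeGraph E F).Reachable 0 a
    · exact ⟨a, b, hpa, hpb, ha, fun hb => hab (ha.symm.trans hb)⟩
    · refine ⟨b, a, hpb, hpa, ?_, ha⟩
      have h1 : ¬ (edgeGraph E F).Reachable a 0 := fun h => ha h.symm
      have h2 : (edgeGraph E F).Reachable b 0 := by
        by_contra h
        exact h1 ((hF.reachable_iff_not_reachable hab 0).2 h)
      exact h2.symm
  set I := univ.filter (fun v => (edgeGraph E F).Reachable 0 v ∧ p v ≠ 0) with hI
  have hflow : momentumFlow E F p = ∑ v ∈ I, p v := by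
    rw [momentumFlow, hI, ← Finset.filter_filter, Finset.sum_filter_ne_zero]
  rw [hflow]
  refine hgen I ⟨a, by simp [hI, ha0, hpa]⟩ (fun v hv => (Finset.mem_filter.1 hv).2.2) ⟨b, by simp [hI, hb0], hpb⟩

open scoped Classical in
/-- `z_Φ` unfolded: `z_Φ(γ) = ℓ(γ) + δ_{m.m.}(γ)`. [cite: Borinsky2020, Theorem 32 and §7.2 (δ_{m.m.}, tropical.tex l.1240–1241)] -/
theorem zSecondSymanzik_apply (p : Fin (V + 1) → W) (m : Fin N → ℝ) (γ : Finset (Fin N)) :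
    zSecondSymanzik E p m γ = loopNumber E γ + if IsMassMomentumSpanning E p m γ then 1 else 0 := rfl

open scoped Classical in
/-- `z_Φ = z_Ψ + δ_{m.m.}` as boolean functions (for Lemma 26's linearity `w^{(σ,z₁+z₂)} = w^{(σ,z₁)} + w^{(σ,z₂)}`).
[cite: Borinsky2020, Theorem 32; §7.2 (tropical.tex l.1240)] -/
theorem zSecondSymanzik_eq_add (p : Fin (V + 1) → W) (m : Fin N → ℝ) :
    zSecondSymanzik E p m = (fun γ : Finset (Fin N) => (loopNumber E γ : ℝ)) +
      fun γ => if IsMassMomentumSpanning E p m γ then (1 : ℝ) else 0 := rfl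

end API

/-! ## Part 3 — `z_Φ = ℓ + δ_{m.m.}` is supermodular (Theorem 32: "the supermodular functions z_{Ψ_G}, z_{Φ_G}") -/

section Supermodularity

variable {E}
variable {W : Type*} [NormedAddCommGroup W]

open Literature.MathematicalPhysics.QuantumFieldTheory.Borinsky2020

/-- **Strict supermodularity of the loop number across an m.m. failure**: if `A` and `B` are m.m. but `A ∩ B` is not, then
`ℓ(A) + ℓ(B) + 1 ≤ ℓ(A ∪ B) + ℓ(A ∩ B)` — the massive edges lie in `A ∩ B`, so some pair of external vertices is joined in `A` and
in `B` but not in `A ∩ B`, and `edgeRank_union_add_inter_add_one_le` applies (with `|A ∪ B| + |A ∩ B| = |A| + |B|`).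
[cite: Schultka2018, Theorem 4.15 (s_G supermodular); Brown2017, Lemma 6.1; Borinsky2020, Theorem 32] -/
theorem loopNumber_add_loopNumber_add_one_le {p : Fin (V + 1) → W} {m : Fin N → ℝ} {A B : Finset (Fin N)}
    (hA : IsMassMomentumSpanning E p m A) (hB : IsMassMomentumSpanning E p m B)
    (hI : ¬ IsMassMomentumSpanning E p m (A ∩ B)) :
    (loopNumber E A : ℝ) + loopNumber E B + 1 ≤ loopNumber E (A ∪ B) + loopNumber E (A ∩ B) := by
  have hmass : ∀ e, m e ≠ 0 → e ∈ A ∩ B := fun e he => Finset.mem_inter.2 ⟨hA.1 e he, hB.1 e he⟩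
  have hms : ¬ IsMomentumSpanning E p (A ∩ B) := fun h => hI ⟨hmass, h⟩
  unfold IsMomentumSpanning at hms
  push Not at hms
  obtain ⟨u, v, hu, hv, huv⟩ := hms
  have hrk := edgeRank_union_add_inter_add_one_le E (hA.2 u v hu hv) (hB.2 u v hu hv) huv
  have hcard := Finset.card_union_add_card_inter A B
  rw [natCast_loopNumber, natCast_loopNumber, natCast_loopNumber, natCast_loopNumber]
  have hrk' : (edgeRank E (A ∪ B) : ℝ) + edgeRank E (A ∩ B) + 1 ≤ edgeRank E A + edgeRank E B := by
    exact_mod_cast hrk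
  have hcard' : ((A ∪ B).card : ℝ) + (A ∩ B).card = A.card + B.card := by exact_mod_cast hcard
  linarith

open scoped Classical in
/-- **`z_{Φ_G}` is supermodular** (Theorem 32: "A facet presentation of these polytopes is given by the supermodular functions
z_{Ψ_G}(γ) = ℓ(γ), z_{Φ_G}(γ) = ℓ(γ)+1 if γ is m.m. in G, ℓ(γ) else"; BMT23 Theorem 3.5: "Consequently, this function z_ℱ :
2^E → ℝ is supermodular"; Schultka Theorem 4.15) — for EVERY edge list and all kinematic data: `ℓ` is supermodular, `δ_{m.m.}`
is monotone, and where `δ_{m.m.}` fails to be supermodular (`A`, `B` m.m., `A ∩ B` not) the loop number is strictly supermodular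
(`loopNumber_add_loopNumber_add_one_le`). [cite: Borinsky2020, Theorem 32 (tropical.tex l.1197–1201); BorinskyMunchTellander2023, Theorem 3.5 (main.tex l.740–748); Schultka2018, Theorem 4.15 (toricfeynman.tex l.2409–2411)] -/
theorem supermodular_zSecondSymanzik (p : Fin (V + 1) → W) (m : Fin N → ℝ) :
    Supermodular (zSecondSymanzik E p m) := by
  intro A B
  simp only [zSecondSymanzik_apply]
  have hℓ := supermodular_loopNumber E A B
  by_cases hA : IsMassMomentumSpanning E p m A <;> by_cases hB : IsMassMomentumSpanning E p m B
  · have hU : IsMassMomentumSpanning E p m (A ∪ B) := hA.mono subset_union_left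
    by_cases hI : IsMassMomentumSpanning E p m (A ∩ B)
    · rw [if_pos hA, if_pos hB, if_pos hU, if_pos hI]
      linarith
    · have hstrict := loopNumber_add_loopNumber_add_one_le hA hB hI
      rw [if_pos hA, if_pos hB, if_pos hU, if_neg hI]
      linarith
  · have hU : IsMassMomentumSpanning E p m (A ∪ B) := hA.mono subset_union_left
    rw [if_pos hA, if_neg hB, if_pos hU]
    split_ifs <;> linarith
  · have hU : IsMassMomentumSpanning E p m (A ∪ B) := hB.mono subset_union_right
    rw [if_neg hA, if_pos hB, if_pos hU]
    split_ifs <;> linarith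
  · rw [if_neg hA, if_neg hB]
    split_ifs <;> linarith

/-- `z_Φ(∅) = 0` unless the empty edge set is m.m. (the standing normalisation of Theorem 23). [cite: Borinsky2020, Theorem 23 (tropical.tex l.1018); Theorem 32] -/
theorem zSecondSymanzik_empty {p : Fin (V + 1) → W} {m : Fin N → ℝ} (h : ¬ IsMassMomentumSpanning E p m ∅) :
    zSecondSymanzik E p m ∅ = 0 := by
  classical
  rw [zSecondSymanzik_apply, loopNumber_empty, if_neg h]
  simp

/-- `z_Φ(E) = ℓ(E) + 1 = deg Φ_G` for a connected edge list ("Φ_G [is] homogeneous of degree ℓ(G)+1"). [cite: Borinsky2020, §7 (tropical.tex l.1176); Theorem 32] -/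
theorem zSecondSymanzik_univ (hconn : IsConnectedEdgeList E) (p : Fin (V + 1) → W) (m : Fin N → ℝ) :
    zSecondSymanzik E p m univ = loopNumber E univ + 1 := by
  classical
  rw [zSecondSymanzik_apply, if_pos (isMassMomentumSpanning_univ hconn p m)]

end Supermodularity

/-! ## Part 4 — the monomials of `Φ_G`: exponent vectors `𝟙_{E∖T₂}` and `𝟙_{E∖T₁} + 𝟙_e`, non-negative coefficients -/

section Support

variable {E}
variable {W : Type*} [NormedAddCommGroup W]

open MvPolynomial

/-- A square-free product of variables is the monomial of its exponent vector `Σ_{e∈S} 𝟙_e` (as in `MatrixTreeTheorem`). [folklore] -/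
private theorem prod_X_eq_monomial (S : Finset (Fin N)) :
    ∏ e ∈ S, (X e : MvPolynomial (Fin N) ℝ) = monomial (∑ e' ∈ S, Finsupp.single e' 1) 1 := by
  classical
  induction S using Finset.induction_on with
  | empty => simp
  | insert e S he ih =>
    rw [Finset.prod_insert he, Finset.sum_insert he, ih, ← pow_one (X e), X_pow_eq_monomial,
      monomial_mul, one_mul]

open scoped Classical in
/-- **`Φ_G` as a sum of monomials**: `Φ_G = Σ_{T₂} ‖p(T₂)‖² X^{𝟙_{E∖T₂}} + Σ_{T₁} Σ_e m_e² X^{𝟙_{E∖T₁} + 𝟙_e}` (eq. (PsiPhi_slow) with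
`Ψ_G = Σ_{T₁} X^{𝟙_{E∖T₁}}`, `MatrixTreeTheorem.kirchhoffPolynomial_eq_sum_monomial`). [cite: Borinsky2020, §7.1 eq. (PsiPhi_slow) (tropical.tex l.1185–1187); Brown2017, Def. 1.3–1.4] -/
theorem secondSymanzikPolynomial_eq_sum_monomial (p : Fin (V + 1) → W) (m : Fin N → ℝ) :
    secondSymanzikPolynomial E p m =
      (∑ F ∈ univ.filter (IsSpanningTwoForest E),
          ‖momentumFlow E F p‖ ^ 2 • monomial (∑ e' ∈ Fᶜ, Finsupp.single e' 1) (1 : ℝ)) +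
        ∑ T ∈ univ.filter (IsSpanningTree E), ∑ e,
          m e ^ 2 • monomial (∑ e' ∈ Tᶜ, Finsupp.single e' 1 + Finsupp.single e 1) (1 : ℝ) := by
  unfold secondSymanzikPolynomial
  congr 1
  · exact Finset.sum_congr rfl fun F _ => by rw [prod_X_eq_monomial]
  · rw [kirchhoffPolynomial_eq_sum_monomial E ℝ, Finset.sum_mul]
    refine Finset.sum_congr (by convert rfl) fun T _ => ?_
    rw [Finset.mul_sum]
    refine Finset.sum_congr rfl fun e _ => ?_
    rw [mul_smul_comm, ← pow_one (X e), X_pow_eq_monomial, monomial_mul, one_mul]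

open scoped Classical in
/-- **The coefficients of `Φ_G`**: the coefficient of `X^d` is `Σ_{T₂ : 𝟙_{E∖T₂} = d} ‖p(T₂)‖² + Σ_{(T₁,e) : 𝟙_{E∖T₁}+𝟙_e = d} m_e²`.
[cite: Borinsky2020, §7.1 eq. (PsiPhi_slow); Brown2017, Def. 1.3–1.4] -/
theorem coeff_secondSymanzikPolynomial (p : Fin (V + 1) → W) (m : Fin N → ℝ) (d : Fin N →₀ ℕ) :
    coeff d (secondSymanzikPolynomial E p m) =
      (∑ F ∈ univ.filter (IsSpanningTwoForest E),
          if ∑ e' ∈ Fᶜ, Finsupp.single e' 1 = d then ‖momentumFlow E F p‖ ^ 2 else 0) +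
        ∑ T ∈ univ.filter (IsSpanningTree E), ∑ e,
          if ∑ e' ∈ Tᶜ, Finsupp.single e' 1 + Finsupp.single e 1 = d then m e ^ 2 else 0 := by
  rw [secondSymanzikPolynomial_eq_sum_monomial, coeff_add, coeff_sum, coeff_sum]
  congr 1
  · refine Finset.sum_congr rfl fun F _ => ?_
    rw [coeff_smul, coeff_monomial, smul_eq_mul, mul_ite, mul_one, mul_zero]
  · refine Finset.sum_congr rfl fun T _ => ?_
    rw [coeff_sum]
    refine Finset.sum_congr rfl fun e _ => ?_
    rw [coeff_smul, coeff_monomial, smul_eq_mul, mul_ite, mul_one, mul_zero]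

/-- **Every coefficient of `Φ_G` is non-negative** in the Euclidean region ("all signs in the definition of Φ_{G_0}(q) are
positive", Brown, proof of Lemma 1.12; real masses). [cite: Brown2017, Lemma 1.12 (proof); Borinsky2020, Theorem 32 (Euclidean kinematics)] -/
theorem coeff_secondSymanzikPolynomial_nonneg (p : Fin (V + 1) → W) (m : Fin N → ℝ) (d : Fin N →₀ ℕ) :
    0 ≤ coeff d (secondSymanzikPolynomial E p m) := by
  classical
  rw [coeff_secondSymanzikPolynomial]
  exact add_nonneg (Finset.sum_nonneg fun F _ => ite_nonneg (by positivity) le_rfl)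
    (Finset.sum_nonneg fun T _ => Finset.sum_nonneg fun e _ => ite_nonneg (by positivity) le_rfl)

/-- The 2-forest term is a lower bound for its coefficient: `‖p(T₂)‖² ≤ [X^{𝟙_{E∖T₂}}] Φ_G` (no cancellations).
[cite: Brown2017, Lemma 1.12 (proof: "It cannot cancel out since all signs … are positive")] -/
theorem sq_norm_momentumFlow_le_coeff {F : Finset (Fin N)} (hF : IsSpanningTwoForest E F) (p : Fin (V + 1) → W)
    (m : Fin N → ℝ) :
    ‖momentumFlow E F p‖ ^ 2 ≤ coeff (∑ e' ∈ Fᶜ, Finsupp.single e' 1) (secondSymanzikPolynomial E p m) := by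
  classical
  rw [coeff_secondSymanzikPolynomial]
  have h1 : ‖momentumFlow E F p‖ ^ 2 ≤ ∑ F' ∈ univ.filter (IsSpanningTwoForest E),
      if ∑ e' ∈ F'ᶜ, Finsupp.single e' 1 = ∑ e' ∈ Fᶜ, Finsupp.single e' (1 : ℕ)
        then ‖momentumFlow E F' p‖ ^ 2 else 0 := by
    refine le_trans ?_ (Finset.single_le_sum (f := fun F' => if ∑ e' ∈ F'ᶜ, Finsupp.single e' 1 =
        ∑ e' ∈ Fᶜ, Finsupp.single e' (1 : ℕ) then ‖momentumFlow E F' p‖ ^ 2 else 0)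
      (fun F' _ => ite_nonneg (by positivity) le_rfl) ((Finset.mem_filter_univ F).2 hF))
    rw [if_pos rfl]
  have h2 : (0 : ℝ) ≤ ∑ T ∈ univ.filter (IsSpanningTree E), ∑ e,
      if ∑ e' ∈ Tᶜ, Finsupp.single e' 1 + Finsupp.single e 1 = ∑ e' ∈ Fᶜ, Finsupp.single e' (1 : ℕ)
        then m e ^ 2 else 0 :=
    Finset.sum_nonneg fun T _ => Finset.sum_nonneg fun e _ => ite_nonneg (by positivity) le_rfl
  linarith

/-- The mass term is a lower bound for its coefficient: `m_e² ≤ [X^{𝟙_{E∖T₁} + 𝟙_e}] Φ_G` (no cancellations).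
[cite: Brown2017, Lemma 1.13 (proof: "the coefficient of α_e² in Ξ_G is m_e² Ψ_{G∖e}")] -/
theorem sq_mass_le_coeff {T : Finset (Fin N)} (hT : IsSpanningTree E T) (e : Fin N) (p : Fin (V + 1) → W)
    (m : Fin N → ℝ) :
    m e ^ 2 ≤ coeff (∑ e' ∈ Tᶜ, Finsupp.single e' 1 + Finsupp.single e 1) (secondSymanzikPolynomial E p m) := by
  classical
  rw [coeff_secondSymanzikPolynomial]
  set d : Fin N →₀ ℕ := ∑ e' ∈ Tᶜ, Finsupp.single e' 1 + Finsupp.single e 1 with hd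
  have h1 : (0 : ℝ) ≤ ∑ F' ∈ univ.filter (IsSpanningTwoForest E),
      if ∑ e' ∈ F'ᶜ, Finsupp.single e' 1 = d then ‖momentumFlow E F' p‖ ^ 2 else 0 :=
    Finset.sum_nonneg fun F' _ => ite_nonneg (by positivity) le_rfl
  have h3 : m e ^ 2 ≤ ∑ e'', if ∑ e' ∈ Tᶜ, Finsupp.single e' 1 + Finsupp.single e'' 1 = d then m e'' ^ 2 else 0 := by
    refine le_trans ?_ (Finset.single_le_sum (f := fun e'' => if ∑ e' ∈ Tᶜ, Finsupp.single e' 1 +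
        Finsupp.single e'' 1 = d then m e'' ^ 2 else 0)
      (fun e'' _ => ite_nonneg (by positivity) le_rfl) (Finset.mem_univ e))
    rw [if_pos rfl]
  have h2 : m e ^ 2 ≤ ∑ T' ∈ univ.filter (IsSpanningTree E), ∑ e'',
      if ∑ e' ∈ T'ᶜ, Finsupp.single e' 1 + Finsupp.single e'' 1 = d then m e'' ^ 2 else 0 := by
    refine le_trans h3 (Finset.single_le_sum (f := fun T' => ∑ e'', if ∑ e' ∈ T'ᶜ, Finsupp.single e' 1 +
        Finsupp.single e'' 1 = d then m e'' ^ 2 else 0)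
      (fun T' _ => Finset.sum_nonneg fun e'' _ => ite_nonneg (by positivity) le_rfl)
      ((Finset.mem_filter_univ T).2 hT))
  linarith

/-- Hence `𝟙_{E∖T₂} ∈ supp Φ_G` for every spanning 2-forest with `p(T₂) ≠ 0`. [cite: Brown2017, Lemma 1.12 (proof); Borinsky2020, eq. (PsiPhi_slow)] -/
theorem sum_single_compl_mem_support_secondSymanzikPolynomial {F : Finset (Fin N)} (hF : IsSpanningTwoForest E F)
    {p : Fin (V + 1) → W} (hp : momentumFlow E F p ≠ 0) (m : Fin N → ℝ) :
    (∑ e' ∈ Fᶜ, Finsupp.single e' (1 : ℕ)) ∈ (secondSymanzikPolynomial E p m).support := by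
  rw [mem_support_iff]
  have h := sq_norm_momentumFlow_le_coeff hF p m
  have hpos : 0 < ‖momentumFlow E F p‖ ^ 2 := by positivity
  exact ne_of_gt (hpos.trans_le h)

/-- Hence `𝟙_{E∖T₁} + 𝟙_e ∈ supp Φ_G` for every spanning tree `T₁` and massive edge `e`. [cite: Brown2017, Lemma 1.13 (proof); Borinsky2020, eq. (PsiPhi_slow)] -/
theorem sum_single_compl_add_single_mem_support_secondSymanzikPolynomial {T : Finset (Fin N)} (hT : IsSpanningTree E T)
    (p : Fin (V + 1) → W) {m : Fin N → ℝ} {e : Fin N} (he : m e ≠ 0) :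
    (∑ e' ∈ Tᶜ, Finsupp.single e' (1 : ℕ) + Finsupp.single e 1) ∈ (secondSymanzikPolynomial E p m).support := by
  rw [mem_support_iff]
  have h := sq_mass_le_coeff hT e p m
  have hpos : 0 < m e ^ 2 := by positivity
  exact ne_of_gt (hpos.trans_le h)

/-- **Every exponent of `Φ_G` comes from a contributing 2-forest or from a (spanning tree, massive edge) pair** ("Monomials in
Φ_G(q) are in one-to-one correspondence with spanning 2-trees T = T_1 ∪ T_2 such that (q^{T_1})² ≠ 0", Brown, proof of Prop. 2.4,
plus the mass terms of `Ξ_G`). [cite: Brown2017, Prop. 2.4 (proof, chunk p0013:L2) and Def. 1.4; Borinsky2020, eq. (PsiPhi_slow)] -/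
theorem exists_of_mem_support_secondSymanzikPolynomial {p : Fin (V + 1) → W} {m : Fin N → ℝ} {d : Fin N →₀ ℕ}
    (hd : d ∈ (secondSymanzikPolynomial E p m).support) :
    (∃ F, IsSpanningTwoForest E F ∧ momentumFlow E F p ≠ 0 ∧ ∑ e' ∈ Fᶜ, Finsupp.single e' 1 = d) ∨
      ∃ T e, IsSpanningTree E T ∧ m e ≠ 0 ∧ ∑ e' ∈ Tᶜ, Finsupp.single e' 1 + Finsupp.single e 1 = d := by
  classical
  rw [mem_support_iff, coeff_secondSymanzikPolynomial] at hd
  by_contra hcon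
  push Not at hcon
  obtain ⟨h1, h2⟩ := hcon
  apply hd
  rw [Finset.sum_eq_zero, Finset.sum_eq_zero, add_zero]
  · intro T hT
    refine Finset.sum_eq_zero fun e _ => ?_
    split_ifs with h
    · have := h2 T e ((Finset.mem_filter_univ T).1 hT)
      by_cases hme : m e = 0
      · rw [hme]; ring
      · exact absurd h (this hme)
    · rfl
  · intro F hF
    split_ifs with h
    · have := h1 F ((Finset.mem_filter_univ F).1 hF)
      by_cases hfl : momentumFlow E F p = 0
      · rw [hfl, norm_zero]; ring
      · exact absurd h (this hfl)
    · rfl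

end Support

/-! ## Part 5 — `supp Φ_G ⊆ 𝒢_{z_Φ}`: every exponent vector satisfies the facet inequalities (39) -/

section Facets

variable {E}
variable {W : Type*} [NormedAddCommGroup W]

open Literature.MathematicalPhysics.QuantumFieldTheory.Borinsky2020

/-- The square-free exponent vector `Σ_{e∈S} 𝟙_e` read in `ℝⁿ` is the indicator vector `1_S`. Plumbing. [folklore] -/
private theorem natCast_sum_single_eq_setIndicator (S : Finset (Fin N)) :
    (fun k => (((∑ e' ∈ S, Finsupp.single e' (1 : ℕ) : Fin N →₀ ℕ) k : ℕ) : ℝ)) = setIndicator S := by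
  funext k
  rw [Finsupp.coe_finsetSum, Finset.sum_apply]
  simp [Finsupp.single_apply, eq_comm, setIndicator]

/-- The exponent vector `Σ_{e∈S} 𝟙_e + 𝟙_{e₀}` read in `ℝⁿ` is `1_S + 1_{{e₀}}`. Plumbing. [folklore] -/
private theorem natCast_sum_single_add_single_eq (S : Finset (Fin N)) (e : Fin N) :
    (fun k => (((∑ e' ∈ S, Finsupp.single e' (1 : ℕ) + Finsupp.single e 1 : Fin N →₀ ℕ) k : ℕ) : ℝ)) =
      setIndicator S + setIndicator {e} := by
  funext k
  rw [Finsupp.add_apply, Nat.cast_add, Pi.add_apply]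
  congr 1
  · exact congrFun (natCast_sum_single_eq_setIndicator S) k
  · simp [Finsupp.single_apply, eq_comm, setIndicator]

/-- `Σ_{i∈I} 1_A(i) = |I ∩ A|`. Plumbing for the facet inequalities. [folklore] -/
private theorem sum_setIndicator (A I : Finset (Fin N)) : ∑ i ∈ I, setIndicator A i = ((I ∩ A).card : ℝ) := by
  simp only [setIndicator]
  rw [Finset.sum_boole, Finset.filter_mem_eq_inter]

/-- The rank is monotone in the edge set (row spans are nested). [cite: Oxley2011, §1.3 (rank axioms, (R2))] -/
theorem edgeRank_mono {A B : Finset (Fin N)} (h : A ⊆ B) : edgeRank E A ≤ edgeRank E B := by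
  rw [edgeRank_eq_finrank_span_incidenceRows, edgeRank_eq_finrank_span_incidenceRows]
  exact Submodule.finrank_mono (span_incidenceRows_mono E h)

open scoped Classical in
/-- **The indicator of a massive edge lies in `𝒢_{δ_{m.m.}}`**: `Σ_i 1_{{e}} = 1 = δ_{m.m.}(E)` (the whole connected graph is m.m.)
and `Σ_{i∈I} 1_{{e}} = [e ∈ I] ≥ δ_{m.m.}(I)` because an m.m. edge set contains every massive edge (mass-spanning).
[cite: Brown2017, Def. 2.6; Borinsky2020, Theorem 32 with Lemma 25] -/
theorem setIndicator_singleton_mem_gpPolytope (hconn : IsConnectedEdgeList E) {p : Fin (V + 1) → W}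
    {m : Fin N → ℝ} {e : Fin N} (he : m e ≠ 0) :
    setIndicator {e} ∈
      gpPolytope (fun γ : Finset (Fin N) => if IsMassMomentumSpanning E p m γ then (1 : ℝ) else 0) := by
  refine ⟨?_, fun I => ?_⟩
  · dsimp only
    rw [sum_setIndicator, Finset.univ_inter, Finset.card_singleton, if_pos (isMassMomentumSpanning_univ hconn p m)]
    simp
  · dsimp only
    rw [sum_setIndicator]
    split_ifs with hI
    · rw [Finset.inter_singleton_of_mem (hI.1 e he), Finset.card_singleton]
      simp
    · positivity

/-- **(F2) The exponent `𝟙_{E∖T₁} + 𝟙_e` of a mass term lies in `𝒢_{z_Φ}`**: `1_{E∖T₁} ∈ 𝒢_{z_Ψ}` (the companion's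
`setIndicator_compl_mem_gpPolytope`) and `1_{{e}} ∈ 𝒢_{δ_{m.m.}}`, added by Lemma 25 (`𝒢_{z₁} + 𝒢_{z₂} ⊆ 𝒢_{z₁+z₂}`).
[cite: Borinsky2020, Theorem 32 and Lemma 25 (tropical.tex l.1197–1201, l.1035–1039); Schultka2018, Theorem 4.15] -/
theorem setIndicator_compl_add_mem_gpPolytope (hconn : IsConnectedEdgeList E) {T : Finset (Fin N)}
    (hT : IsSpanningTree E T) (p : Fin (V + 1) → W) {m : Fin N → ℝ} {e : Fin N} (he : m e ≠ 0) :
    setIndicator Tᶜ + setIndicator {e} ∈ gpPolytope (zSecondSymanzik E p m) := by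
  rw [zSecondSymanzik_eq_add]
  exact add_mem_gpPolytope (setIndicator_compl_mem_gpPolytope E hconn hT)
    (setIndicator_singleton_mem_gpPolytope hconn he)

/-- **(F1) The exponent `𝟙_{E∖T₂}` of a contributing 2-forest lies in `𝒢_{z_Φ}`**: `Σ_{e∈I} 1_{E∖T₂}(e) = |I| − |I ∩ T₂| ≥ |I| − rk I
= ℓ(I)` since `I ∩ T₂` is a forest, with STRICT inequality when `I` is m.m.: if `rk(I ∩ T₂) = rk I` the components of `I ∩ T₂`
are those of `I` (`reachable_iff_reachable_of_subset_of_edgeRank_eq`), so the external vertices would all be joined inside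
`T₂`, contradicting `p(T₂) ≠ 0` (momentum conservation); and `|E ∖ T₂| = ℓ(E) + 1 = z_Φ(E)`.
[cite: Borinsky2020, Theorem 32 (tropical.tex l.1197–1201); Brown2017, Prop. 2.4 (proof); Schultka2018, Theorem 4.15] -/
theorem setIndicator_compl_twoForest_mem_gpPolytope (hconn : IsConnectedEdgeList E) {p : Fin (V + 1) → W}
    (hcons : ∑ v, p v = 0) {F : Finset (Fin N)} (hF : IsSpanningTwoForest E F) (hflow : momentumFlow E F p ≠ 0)
    (m : Fin N → ℝ) : setIndicator Fᶜ ∈ gpPolytope (zSecondSymanzik E p m) := by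
  classical
  have hms := not_isMomentumSpanning_of_momentumFlow_ne_zero hcons hflow
  refine ⟨?_, fun I => ?_⟩
  · rw [sum_setIndicator, Finset.univ_inter, zSecondSymanzik_univ hconn, natCast_loopNumber,
      (isConnectedEdgeList_iff_edgeRank_univ E).1 hconn, Finset.card_compl, Nat.cast_sub (card_le_univ F),
      Finset.card_univ, Fintype.card_fin]
    have h1 : (F.card : ℝ) + 1 = V := by exact_mod_cast hF.1
    linarith
  · rw [sum_setIndicator, zSecondSymanzik_apply, natCast_loopNumber]
    have hIF : edgeRank E (I ∩ F) = (I ∩ F).card := edgeRank_eq_card_of_subset hF.2 inter_subset_right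
    have hle : edgeRank E (I ∩ F) ≤ edgeRank E I := edgeRank_mono inter_subset_left
    have h2 : ((I ∩ Fᶜ).card : ℝ) + (I ∩ F).card = I.card := by
      rw [← Finset.sdiff_eq_inter_compl]
      exact_mod_cast Finset.card_sdiff_add_card_inter I F
    split_ifs with hI
    · have hlt : edgeRank E (I ∩ F) < edgeRank E I := by
        refine lt_of_le_of_ne hle fun heq => hms ?_
        have hIF' : IsMomentumSpanning E p (I ∩ F) := fun u v hu hv =>
          (reachable_iff_reachable_of_subset_of_edgeRank_eq E inter_subset_left heq u v).2 (hI.2 u v hu hv)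
        exact hIF'.mono inter_subset_right
      have h3 : ((I ∩ F).card : ℝ) + 1 ≤ edgeRank E I := by
        rw [← hIF]
        exact_mod_cast hlt
      linarith
    · have h3 : ((I ∩ F).card : ℝ) ≤ edgeRank E I := by
        rw [← hIF]
        exact_mod_cast hle
      linarith

/-- **`supp Φ_G ⊆ 𝒢_{z_Φ}`** (the inclusion `NP_Φ ⊆ P[z_Φ]` of Theorem 32 / BMT23 Theorems 3.5 and 3.9, on the exponents): every exponent
vector of `Φ_G` is `𝟙_{E∖T₂}` with `p(T₂) ≠ 0` or `𝟙_{E∖T₁} + 𝟙_e` with `m_e ≠ 0`, and both satisfy the facet presentation.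
[cite: Borinsky2020, Theorem 32; BorinskyMunchTellander2023, Theorem 3.5; Schultka2018, Theorem 4.15] -/
theorem natCast_mem_gpPolytope_of_mem_support (hconn : IsConnectedEdgeList E) {p : Fin (V + 1) → W}
    (hcons : ∑ v, p v = 0) {m : Fin N → ℝ} {d : Fin N →₀ ℕ} (hd : d ∈ (secondSymanzikPolynomial E p m).support) :
    (fun k => ((d k : ℕ) : ℝ)) ∈ gpPolytope (zSecondSymanzik E p m) := by
  rcases exists_of_mem_support_secondSymanzikPolynomial hd with ⟨F, hF, hflow, rfl⟩ | ⟨T, e, hT, he, rfl⟩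
  · rw [natCast_sum_single_eq_setIndicator]
    exact setIndicator_compl_twoForest_mem_gpPolytope hconn hcons hF hflow m
  · rw [natCast_sum_single_add_single_eq]
    exact setIndicator_compl_add_mem_gpPolytope hconn hT p he

end Facets

/-! ## Part 6 — every vertex `w^{(σ,z_Φ)}` of `𝒢_{z_Φ}` is an exponent of `Φ_G` (Kruskal's tree + the first m.m. link of the chain) -/

section Vertices

variable {E}
variable {W : Type*} [NormedAddCommGroup W]

open Literature.MathematicalPhysics.QuantumFieldTheory.Borinsky2020

/-- The chain sets are nested: `A^σ_k ⊆ A^σ_{k'}` for `k ≤ k'`. [cite: Borinsky2020, Lemma 26 (tropical.tex l.1049)] -/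
theorem chainSet_mono (σ : Equiv.Perm (Fin N)) {k k' : ℕ} (h : k ≤ k') : chainSet σ k ⊆ chainSet σ k' :=
  fun _ hi => mem_chainSet.2 (lt_of_lt_of_le (mem_chainSet.1 hi) h)

open scoped Classical in
/-- **The Fujishige–Tomizawa vertex of `𝒢_{δ_{m.m.}}` at `σ` is the indicator of ONE edge**: along the chain
`∅ = A^σ_0 ⊂ A^σ_1 ⊂ ⋯ ⊂ A^σ_n = E` the monotone boolean function `δ_{m.m.}` jumps from `0` (at `∅`, non-trivial kinematics) to
`1` (at `E`, connected) exactly once, at the first `k` with `A^σ_k` m.m.; so `w^{(σ,δ)} = 1_{{σ(k)}}` by eq. (41).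
[cite: Borinsky2020, Lemma 26 eq. (41) (tropical.tex l.1045–1049); Theorem 32] -/
theorem exists_ftVertex_mmIndicator_eq (hconn : IsConnectedEdgeList E) {p : Fin (V + 1) → W} {m : Fin N → ℝ}
    (h0 : ¬ IsMassMomentumSpanning E p m ∅) (σ : Equiv.Perm (Fin N)) :
    ∃ j : Fin N, ¬ IsMassMomentumSpanning E p m (chainSet σ j) ∧
      IsMassMomentumSpanning E p m (chainSet σ ((j : ℕ) + 1)) ∧
      ftVertex (fun γ : Finset (Fin N) => if IsMassMomentumSpanning E p m γ then (1 : ℝ) else 0) σ =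
        setIndicator {σ j} := by
  have huniv := isMassMomentumSpanning_univ hconn p m
  have hN : 0 < N := by
    rcases Nat.eq_zero_or_pos N with h | h
    · subst h
      rw [Finset.univ_eq_empty] at huniv
      exact absurd huniv h0
    · exact h
  have hwit : IsMassMomentumSpanning E p m (chainSet σ (N - 1 + 1)) := by
    rw [Nat.sub_add_cancel hN, chainSet_of_le σ le_rfl]
    exact huniv
  have hex : ∃ k, IsMassMomentumSpanning E p m (chainSet σ (k + 1)) := ⟨N - 1, hwit⟩
  set j := Nat.find hex with hj
  have hjspec : IsMassMomentumSpanning E p m (chainSet σ (j + 1)) := Nat.find_spec hex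
  have hjlt : j < N := by
    have := Nat.find_min' hex hwit
    omega
  have hjnot : ¬ IsMassMomentumSpanning E p m (chainSet σ j) := by
    rcases Nat.eq_zero_or_pos j with hz | hpos
    · rw [hz, chainSet_zero]
      exact h0
    · have := Nat.find_min hex (m := j - 1) (by omega)
      rwa [Nat.sub_add_cancel hpos] at this
  refine ⟨⟨j, hjlt⟩, hjnot, hjspec, ?_⟩
  funext i
  obtain ⟨i, rfl⟩ : ∃ i', σ i' = i := ⟨σ.symm i, σ.apply_symm_apply i⟩
  rw [ftVertex_apply]
  simp only [setIndicator, Finset.mem_singleton, σ.injective.eq_iff]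
  by_cases hij : i = ⟨j, hjlt⟩
  · subst hij
    rw [if_pos hjspec, if_neg hjnot, if_pos rfl]
    ring
  · rw [if_neg hij]
    have hne : (i : ℕ) ≠ j := fun h => hij (Fin.ext h)
    rcases lt_or_gt_of_ne hne with hlt | hgt
    · have h1 : ¬ IsMassMomentumSpanning E p m (chainSet σ ((i : ℕ) + 1)) := fun h =>
        hjnot (h.mono (chainSet_mono σ (by omega)))
      have h2 : ¬ IsMassMomentumSpanning E p m (chainSet σ i) := fun h =>
        hjnot (h.mono (chainSet_mono σ (by omega)))
      rw [if_neg h1, if_neg h2]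
      ring
    · have h1 : IsMassMomentumSpanning E p m (chainSet σ ((i : ℕ) + 1)) :=
        hjspec.mono (chainSet_mono σ (by omega))
      have h2 : IsMassMomentumSpanning E p m (chainSet σ i) := hjspec.mono (chainSet_mono σ (by omega))
      rw [if_pos h1, if_pos h2]
      ring

/-- The indicator of `insert a S` splits when `a ∉ S`: `1_{S ∪ {a}} = 1_S + 1_{{a}}`. [folklore] -/
private theorem setIndicator_insert {S : Finset (Fin N)} {a : Fin N} (ha : a ∉ S) :
    setIndicator (insert a S) = setIndicator S + setIndicator {a} := by
  funext k
  simp only [setIndicator, Finset.mem_insert, Finset.mem_singleton, Pi.add_apply]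
  by_cases h1 : k = a
  · subst h1
    rw [if_pos (Or.inl rfl), if_neg ha, if_pos rfl]
    ring
  · by_cases h2 : k ∈ S
    · rw [if_pos (Or.inr h2), if_pos h2, if_neg h1]
      ring
    · rw [if_neg (by tauto), if_neg h2, if_neg h1]
      ring

open scoped Classical in
/-- **Every vertex `w^{(σ,z_Φ)}` is an exponent vector of `Φ_G`** (the inclusion `P[z_Φ] ⊆ NP_Φ` of Theorem 32 / BMT23 Theorem
3.4 on the vertices), for a connected edge list with conserved, generic momenta and non-trivial kinematics. By Lemma 26's
linearity `w^{(σ,z_Φ)} = w^{(σ,ℓ)} + w^{(σ,δ)} = 1_{E∖T_σ} + 1_{{e*}}` with `T_σ` Kruskal's tree of `σ` (Remark 33;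
`ftVertex_loopNumber_eq_setIndicator_compl`) and `e* = σ(k)` the edge at which the chain first becomes m.m.
(`exists_ftVertex_mmIndicator_eq`). If `e*` is massive this is the mass monomial `X^{𝟙_{E∖T_σ}} x_{e*}` of `Ψ_G Σ_e m_e² x_e`.
Otherwise `A^σ_{k−1}` already contains the massive edges, so adding `e*` JOINS two groups of external vertices: it raises the
rank (`reachable_iff_reachable_of_subset_of_edgeRank_eq`), hence `e* ∈ T_σ`, and `T_σ ∖ e*` is a spanning 2-forest SEPARATING the
external vertices (a strict-submodularity count inside the forest `T_σ`, `edgeRank_union_add_inter_add_one_le`) — so by generic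
momenta `p(T_σ ∖ e*) ≠ 0` (Brown Lemma 1.12) and `𝟙_{E∖(T_σ∖e*)} = 1_{E∖T_σ} + 1_{{e*}}` is the exponent of a 2-forest monomial.
[cite: Borinsky2020, Theorem 32 and Remark 33 (tropical.tex l.1197–1223); BorinskyMunchTellander2023, Theorem 3.5; Brown2017, Lemma 1.12; Schultka2018, Theorem 4.15] -/
theorem exists_mem_support_natCast_eq_ftVertex (hconn : IsConnectedEdgeList E) {p : Fin (V + 1) → W}
    (hgen : IsGenericMomenta p) {m : Fin N → ℝ} (h0 : ¬ IsMassMomentumSpanning E p m ∅)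
    (σ : Equiv.Perm (Fin N)) :
    ∃ d ∈ (secondSymanzikPolynomial E p m).support, (fun k => ((d k : ℕ) : ℝ)) = ftVertex (zSecondSymanzik E p m) σ := by
  obtain ⟨T, hT, hcount⟩ := exists_isSpanningTree_card_inter_chainSet E hconn σ
  obtain ⟨j, hjnot, hjspec, hδ⟩ := exists_ftVertex_mmIndicator_eq hconn h0 σ
  have hw : ftVertex (zSecondSymanzik E p m) σ = setIndicator Tᶜ + setIndicator {σ j} := by
    rw [zSecondSymanzik_eq_add, ftVertex_add, ftVertex_loopNumber_eq_setIndicator_compl E hcount, hδ]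
  by_cases hmass : m (σ j) ≠ 0
  · exact ⟨_, sum_single_compl_add_single_mem_support_secondSymanzikPolynomial hT p hmass,
      by rw [hw, natCast_sum_single_add_single_eq]⟩
  rw [not_ne_iff] at hmass
  set A := chainSet σ j with hA
  have hA1 : chainSet σ ((j : ℕ) + 1) = insert (σ j) A := by
    rw [hA, chainSet_succ σ j.2, Fin.eta]
  have hnotin : σ j ∉ A := by
    have := apply_not_mem_chainSet σ j.2
    rwa [Fin.eta] at this
  have hmassA : ∀ e, m e ≠ 0 → e ∈ A := by
    intro e he
    have h1 := hjspec.1 e he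
    rw [hA1, Finset.mem_insert] at h1
    rcases h1 with rfl | h1
    · exact absurd hmass he
    · exact h1
  have hmsA : ¬ IsMomentumSpanning E p A := fun h => hjnot ⟨hmassA, h⟩
  have hmsA1 : IsMomentumSpanning E p (insert (σ j) A) := hA1 ▸ hjspec.2
  -- the edge `σ j` joins two groups of external vertices, so Kruskal's tree contains it
  have heT : σ j ∈ T := by
    by_contra heT
    apply hmsA
    have hrk : edgeRank E A = edgeRank E (insert (σ j) A) := by
      rw [hA, ← hcount j, ← hA, ← hA1, ← hcount ((j : ℕ) + 1), hA1, Finset.inter_insert_of_notMem heT]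
    intro u v hu hv
    exact (reachable_iff_reachable_of_subset_of_edgeRank_eq E (Finset.subset_insert _ _) hrk u v).2
      (hmsA1 u v hu hv)
  set X := T ∩ A with hX
  have hTindep : edgeRank E T = T.card := hT.2.trans hT.1.symm
  have hXrk : edgeRank E X = X.card := edgeRank_eq_card_of_subset hTindep inter_subset_left
  have hXA : edgeRank E X = edgeRank E A := by rw [hXrk, hX, hcount]
  have hX'sub : insert (σ j) X ⊆ T := Finset.insert_subset heT inter_subset_left
  have hX'eq : T ∩ insert (σ j) A = insert (σ j) X := by rw [hX, Finset.inter_insert_of_mem heT]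
  have hX'rk : edgeRank E (insert (σ j) X) = (insert (σ j) X).card := edgeRank_eq_card_of_subset hTindep hX'sub
  have hX'A1 : edgeRank E (insert (σ j) X) = edgeRank E (insert (σ j) A) := by
    rw [← hX'eq, ← hA1, edgeRank_eq_card_of_subset hTindep inter_subset_left, hcount]
  have hnotinX : σ j ∉ X := fun h => hnotin (Finset.mem_inter.1 h).2
  unfold IsMomentumSpanning at hmsA
  push Not at hmsA
  obtain ⟨u, v, hu, hv, huvA⟩ := hmsA
  have huvX : ¬ (edgeGraph E X).Reachable u v := fun h =>
    huvA ((reachable_iff_reachable_of_subset_of_edgeRank_eq E inter_subset_right hXA u v).1 h)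
  have huvX' : (edgeGraph E (insert (σ j) X)).Reachable u v :=
    (reachable_iff_reachable_of_subset_of_edgeRank_eq E (Finset.insert_subset_insert _ inter_subset_right)
      hX'A1 u v).2 (hmsA1 u v hu hv)
  -- `T ∖ σ j` is a spanning 2-forest separating `u` from `v`
  set F := T.erase (σ j) with hF
  have hF2 : IsSpanningTwoForest E F := hT.isSpanningTwoForest_erase heT
  have hmsF : ¬ IsMomentumSpanning E p F := by
    intro hF'
    have hFX' : F ∩ insert (σ j) X = X := by
      ext x
      simp only [hF, hX, Finset.mem_inter, Finset.mem_erase, Finset.mem_insert]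
      constructor
      · rintro ⟨⟨hne, hxT⟩, h | h⟩
        · exact absurd h hne
        · exact h
      · rintro ⟨hxT, hxA⟩
        exact ⟨⟨fun h => hnotin (h ▸ hxA), hxT⟩, Or.inr ⟨hxT, hxA⟩⟩
    have hFX'u : F ∪ insert (σ j) X = T := by
      ext x
      simp only [hF, hX, Finset.mem_union, Finset.mem_erase, Finset.mem_insert, Finset.mem_inter]
      constructor
      · rintro (⟨-, hxT⟩ | rfl | ⟨hxT, -⟩)
        · exact hxT
        · exact heT
        · exact hxT
      · intro hxT
        by_cases hx : x = σ j
        · exact Or.inr (Or.inl hx)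
        · exact Or.inl ⟨hx, hxT⟩
    have hstrict := edgeRank_union_add_inter_add_one_le E (hF' u v hu hv) huvX' (by rw [hFX']; exact huvX)
    rw [hFX'u, hFX', hTindep, hXrk, hF2.2, hX'rk, Finset.card_insert_of_notMem hnotinX, hF,
      Finset.card_erase_of_mem heT] at hstrict
    have := Finset.card_pos.2 ⟨σ j, heT⟩
    omega
  have hflow := momentumFlow_ne_zero_of_not_isMomentumSpanning hF2 hgen hmsF
  refine ⟨_, sum_single_compl_mem_support_secondSymanzikPolynomial hF2 hflow m, ?_⟩
  rw [natCast_sum_single_eq_setIndicator, hw, hF, Finset.compl_erase,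
    setIndicator_insert (fun h => (Finset.mem_compl.1 h) heT)]

end Vertices

/-! ## Part 7 — THEOREM 32, the `Φ`-part (= BMT23 Theorem 3.5): `NP_{Φ_G} = 𝒢_{z_Φ}` -/

/-- The exponent vectors `ℓ ∈ supp(p) ⊂ ℤⁿ` of `p` "interpreted as vectors in ℝⁿ" — the same local notation as in
`Borinsky2020/ConvergenceTheorem.lean`, `GeneralizedPermutahedronSampling.lean`, `KirchhoffPermutahedron.lean` (no new definition). -/
local notation3 (prettyPrint := false) "pts⟦" p "⟧" =>
  ((fun d : (_ →₀ ℕ) => fun k => ((d k : ℕ) : ℝ)) '' {d | d ∈ MvPolynomial.support p})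

/-- The Newton polytope `NP_p = conv(supp p)` — the same local notation as in `Borinsky2020/ConvergenceTheorem.lean`
(no new definition). -/
local notation3 (prettyPrint := false) "NP⟦" p "⟧" => convexHull ℝ pts⟦p⟧

section Main

/-- A facet presentation with `z(∅) > 0` cuts out the EMPTY polytope (the inequality for `I = ∅` reads `0 ≥ z(∅)`); this is the
degenerate case `Φ_G = 0` of trivial kinematics, where `z_Φ(∅) = 1`. [cite: Borinsky2020, Theorem 23 eq. (39) (tropical.tex l.1016–1018)] -/
theorem Borinsky2020.gpPolytope_eq_empty_of_pos {n : ℕ} {z : Finset (Fin n) → ℝ} (h : 0 < z ∅) :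
    gpPolytope z = ∅ := by
  ext v
  simp only [Set.mem_empty_iff_false, iff_false]
  intro hv
  have := hv.2 ∅
  rw [Finset.sum_empty] at this
  linarith

variable {E}
variable {W : Type*} [NormedAddCommGroup W]

open MvPolynomial
open Literature.MathematicalPhysics.QuantumFieldTheory.Borinsky2020

/-- **Trivial kinematics on the empty edge set force trivial kinematics**: if `∅` is m.m. (no massive edge, at most one vertex
with non-zero momentum) then by momentum conservation ALL momenta vanish ("there exist at least two vertices v_1, v_2 with
non-zero total incoming momenta", Brown, proof of Lemma 1.12). [cite: Brown2017, Lemma 1.12 (proof) and eq. (momcons)] -/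
theorem forall_eq_zero_of_isMassMomentumSpanning_empty {p : Fin (V + 1) → W} (hcons : ∑ v, p v = 0) {m : Fin N → ℝ}
    (h : IsMassMomentumSpanning E p m ∅) : (∀ e, m e = 0) ∧ ∀ v, p v = 0 := by
  rw [isMassMomentumSpanning_empty_iff] at h
  refine ⟨h.1, fun v => ?_⟩
  by_contra hv
  have hsum : ∑ w, p w = p v :=
    Finset.sum_eq_single v (fun w _ hw => by
      by_contra hw'
      exact hw (h.2 w v hw' hv)) (fun h' => absurd (Finset.mem_univ v) h')
  exact hv (hsum ▸ hcons)

open scoped Classical in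
/-- With no masses and no momenta `Φ_G = 0` (Brown Lemma 1.13, the trivial direction). [cite: Brown2017, Lemma 1.13] -/
theorem secondSymanzikPolynomial_eq_zero_of_forall_eq_zero {p : Fin (V + 1) → W} {m : Fin N → ℝ} (hm : ∀ e, m e = 0)
    (hp : ∀ v, p v = 0) : secondSymanzikPolynomial E p m = 0 := by
  have hflow : ∀ F : Finset (Fin N), momentumFlow E F p = 0 := fun F => by
    unfold momentumFlow
    exact Finset.sum_eq_zero fun v _ => hp v
  unfold secondSymanzikPolynomial
  simp [hflow, hm]

/-- **THEOREM 32, the `Φ`-part (Borinsky 2020; = Borinsky–Munch–Tellander 2023 Theorem 3.5; Schultka 2018 Theorem 4.15), AS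
PRINTED: "If we restrict to Euclidean and non-exceptional kinematics, then the Newton polytope of … Φ_G [is a] generalized
permutahedr[on]. A facet presentation … is given by the supermodular function z_{Φ_G}(γ) = ℓ(γ)+1 if γ is m.m. in G, ℓ(γ)
else" / "In the Euclidean regime with generic kinematics, the Newton polytope N[ℱ] is a generalized permutahedron. It is equal to
the base polytope P[z_ℱ] with … z_ℱ(γ) = L_γ + 1 if γ is mass-momentum spanning and z_ℱ(γ) = L_γ otherwise."** For a connected
edge list, incoming momenta `p` with `Σ_v p_v = 0` (momentum conservation) that are generic (`IsGenericMomenta`), and real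
masses `m`: `NP_{Φ_G} = 𝒢_{z_Φ}` in the facet presentation (39) (the tree's `gpPolytope`; `= P[z_ℱ]`). No non-triviality
hypothesis: for trivial kinematics both sides are empty (`Φ_G = 0`, `z_Φ(∅) = 1`). Proof route (disclosed): the print cites
Schultka's inductive proof via Brown's infra-red factorisation (Theorem 2.7 / Prop. 2.4); we follow instead the Kruskal route of
Remark 33 as for `Ψ_G` (`KirchhoffPermutahedron.lean`): `supp Φ ⊆ 𝒢_{z_Φ}` facet by facet (Part 5), every vertex `w^{(σ,z_Φ)} =
1_{E∖T_σ} + 1_{{e*}}` is an exponent (Part 6), and a subset of `𝒢_z` containing its vertices spans it (`convexHull_eq_gpPolytope`,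
Hahn–Banach). [cite: Borinsky2020, Theorem 32 (tropical.tex l.1197–1206); BorinskyMunchTellander2023, Theorem 3.5 (main.tex l.740–752); Schultka2018, Theorem 4.15 (toricfeynman.tex l.2409–2411); Brown2017, Theorem 2.7] -/
theorem newtonPolytope_secondSymanzikPolynomial_eq_gpPolytope (hconn : IsConnectedEdgeList E) {p : Fin (V + 1) → W}
    (hcons : ∑ v, p v = 0) (hgen : IsGenericMomenta p) (m : Fin N → ℝ) :
    NP⟦secondSymanzikPolynomial E p m⟧ = gpPolytope (zSecondSymanzik E p m) := by
  classical
  by_cases h0 : IsMassMomentumSpanning E p m ∅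
  · obtain ⟨hm, hp⟩ := forall_eq_zero_of_isMassMomentumSpanning_empty hcons h0
    rw [secondSymanzikPolynomial_eq_zero_of_forall_eq_zero hm hp,
      gpPolytope_eq_empty_of_pos (by rw [zSecondSymanzik_apply, if_pos h0, loopNumber_empty]; simp)]
    simp
  · refine convexHull_eq_gpPolytope (supermodular_zSecondSymanzik p m) (zSecondSymanzik_empty h0) ?_ ?_
    · rintro _ ⟨d, hd, rfl⟩
      exact natCast_mem_gpPolytope_of_mem_support hconn hcons hd
    · intro σ
      obtain ⟨d, hd, hdw⟩ := exists_mem_support_natCast_eq_ftVertex hconn hgen h0 σ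
      exact ⟨d, hd, hdw⟩

/-- **BMT23 Theorem 3.9** ("Even if N[ℱ] ≠ P[z_ℱ], the Newton polytope N[ℱ] is *bounded* by the base polytope P[z_ℱ]. The reason
for this is that ℱ can only lose monomials if we make the kinematics less generic. **Theorem 3.9.** We have N[ℱ] ⊂ P[z_ℱ].") —
for the Euclidean (vector-momentum) typing of this file with ARBITRARY, also exceptional, conserved momenta and real masses on a
connected edge list, NO genericity hypothesis: `NP_{Φ_G} ⊆ 𝒢_{z_Φ}`. (For generic momenta Part 7 gives equality.) [cite: BorinskyMunchTellander2023, Theorem 3.9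
(main.tex l.855–859)] -/
theorem newtonPolytope_secondSymanzikPolynomial_subset_gpPolytope (hconn : IsConnectedEdgeList E) {p : Fin (V + 1) → W}
    (hcons : ∑ v, p v = 0) (m : Fin N → ℝ) :
    NP⟦secondSymanzikPolynomial E p m⟧ ⊆ gpPolytope (zSecondSymanzik E p m) :=
  convexHull_min (by
    rintro v ⟨d, hd, rfl⟩
    exact natCast_mem_gpPolytope_of_mem_support hconn hcons hd) (convex_gpPolytope _)

/-- "**the Newton polytope of … Φ_G [is a] generalized permutahedr[on]**" / "N[ℱ] is a generalized permutahedron. … Consequently,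
this function z_ℱ : 2^E → ℝ is supermodular" — in the tree's typing (Theorem 23's facet presentation as the definition, as in
BMT23: "we will take Theorem 3.3 as our definition"): `NP_{Φ_G} = 𝒢_z` for a supermodular `z` with `z(∅) = 0`, provided the
kinematics are non-trivial (some massive edge or some non-zero momentum; otherwise `Φ_G = 0`).
[cite: Borinsky2020, Theorem 32; BorinskyMunchTellander2023, Theorem 3.5 and §3.3 (main.tex l.697, l.740–748)] -/
theorem exists_supermodular_newtonPolytope_secondSymanzikPolynomial_eq (hconn : IsConnectedEdgeList E) {p : Fin (V + 1) → W}
    (hcons : ∑ v, p v = 0) (hgen : IsGenericMomenta p) {m : Fin N → ℝ}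
    (hnt : (∃ e, m e ≠ 0) ∨ ∃ v, p v ≠ 0) :
    ∃ z : Finset (Fin N) → ℝ, Supermodular z ∧ z ∅ = 0 ∧ NP⟦secondSymanzikPolynomial E p m⟧ = gpPolytope z := by
  refine ⟨_, supermodular_zSecondSymanzik p m, zSecondSymanzik_empty fun h0 => ?_,
    newtonPolytope_secondSymanzikPolynomial_eq_gpPolytope hconn hcons hgen m⟩
  obtain ⟨hm, hp⟩ := forall_eq_zero_of_isMassMomentumSpanning_empty hcons h0
  rcases hnt with ⟨e, he⟩ | ⟨v, hv⟩
  · exact he (hm e)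
  · exact hv (hp v)

/-- **Brown Lemma 1.13 in the Euclidean region: `Φ_G = 0` iff there are no masses and no momenta** ("If (genericmomenta) and
(genericmassmomenta) hold then Ξ_G(q,m) = 0 if and only if G has no massive edges, and no incoming momenta"), for a connected
edge list with conserved generic momenta — the non-trivial direction being Lemma 1.12's separating 2-forest, here read off the
vertex `w^{(σ,z_Φ)}` for `σ = 1`. [cite: Brown2017, Lemma 1.12 and Lemma 1.13] -/
theorem secondSymanzikPolynomial_eq_zero_iff (hconn : IsConnectedEdgeList E) {p : Fin (V + 1) → W} (hcons : ∑ v, p v = 0)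
    (hgen : IsGenericMomenta p) (m : Fin N → ℝ) :
    secondSymanzikPolynomial E p m = 0 ↔ (∀ e, m e = 0) ∧ ∀ v, p v = 0 := by
  constructor
  · intro hΦ
    by_contra hnt
    have h0 : ¬ IsMassMomentumSpanning E p m ∅ := fun h =>
      hnt (forall_eq_zero_of_isMassMomentumSpanning_empty hcons h)
    obtain ⟨d, hd, -⟩ := exists_mem_support_natCast_eq_ftVertex hconn hgen h0 1
    rw [hΦ, support_zero] at hd
    exact Finset.notMem_empty d hd
  · rintro ⟨hm, hp⟩
    exact secondSymanzikPolynomial_eq_zero_of_forall_eq_zero hm hp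

/-- `Φ_G ≠ 0` forces non-trivial kinematics on `∅`: `z_Φ(∅) = 0`. [cite: Brown2017, Lemma 1.13; Borinsky2020, Theorem 23 (z(∅) = 0)] -/
theorem not_isMassMomentumSpanning_empty_of_ne_zero {p : Fin (V + 1) → W} (hcons : ∑ v, p v = 0) {m : Fin N → ℝ}
    (hΦ : secondSymanzikPolynomial E p m ≠ 0) : ¬ IsMassMomentumSpanning E p m ∅ := fun h0 => by
  obtain ⟨hm, hp⟩ := forall_eq_zero_of_isMassMomentumSpanning_empty hcons h0
  exact hΦ (secondSymanzikPolynomial_eq_zero_of_forall_eq_zero hm hp)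

end Main

/-! ## Part 8 — the tropical reading: `Φ^tr_G|_{Exp C_σ} = x^{w^{(σ,z_Φ)}} = (Π_{e∉T_σ} x_e) · x_{e*}` -/

section Tropical

variable {E}
variable {W : Type*} [NormedAddCommGroup W]

open MvPolynomial
open Literature.MathematicalPhysics.QuantumFieldTheory.Borinsky2020

/-- **The support function of `NP_{Φ_G}` is `h_{z_Φ}`**: `max_{ℓ∈supp Φ} ⟨y,ℓ⟩ = max_{v∈𝒢_{z_Φ}} ⟨y,v⟩ = ⟨y, w^{(σ_y,z_Φ)}⟩` for every
`y` (eq. (logPtr) with Lemma 26, for `ℬ ∋ NP_{Φ_G}`), `Φ_G ≠ 0`. [cite: Borinsky2020, eq. (logPtr) (tropical.tex l.415–419), proof of Theorem 27 (l.1075–1079), Theorem 32] -/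
theorem faceValue_secondSymanzikPolynomial_eq_gpSupport (hconn : IsConnectedEdgeList E) {p : Fin (V + 1) → W}
    (hcons : ∑ v, p v = 0) (hgen : IsGenericMomenta p) {m : Fin N → ℝ} (hΦ : secondSymanzikPolynomial E p m ≠ 0)
    (y : Fin N → ℝ) : faceValue (secondSymanzikPolynomial E p m) y = gpSupport (zSecondSymanzik E p m) y := by
  have h0 := not_isMassMomentumSpanning_empty_of_ne_zero hcons hΦ
  have hz0 := zSecondSymanzik_empty h0
  apply le_antisymm
  · obtain ⟨d, hd, hdy⟩ := exists_pairing_eq_faceValue hΦ y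
    rw [← hdy, ← dotProduct_natCast_eq_pairing]
    exact inner_le_gpSupport hz0 (natCast_mem_gpPolytope_of_mem_support hconn hcons hd) y
  · obtain ⟨d, hd, hdw⟩ := exists_mem_support_natCast_eq_ftVertex hconn hgen h0 (Tuple.sort y)
    have hw : gpSupport (zSecondSymanzik E p m) y = pairing y d := by
      rw [← dotProduct_natCast_eq_pairing, hdw]
      rfl
    rw [hw]
    exact pairing_le_faceValue hd y

/-- `Φ^tr_G(e^y) = e^{h_{z_Φ}(y)}` in logarithmic coordinates (eq. (logPtr): "p^tr(x) = exp(max_{v∈NP_p} yᵀv)").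
[cite: Borinsky2020, eq. (logPtr) (tropical.tex l.415–419); Theorem 32] -/
theorem trop_secondSymanzikPolynomial_exp (hconn : IsConnectedEdgeList E) {p : Fin (V + 1) → W} (hcons : ∑ v, p v = 0)
    (hgen : IsGenericMomenta p) {m : Fin N → ℝ} (hΦ : secondSymanzikPolynomial E p m ≠ 0) (y : Fin N → ℝ) :
    trop (secondSymanzikPolynomial E p m) (fun e => Real.exp (y e)) = Real.exp (gpSupport (zSecondSymanzik E p m) y) := by
  rw [trop_exp hΦ, faceValue_secondSymanzikPolynomial_eq_gpSupport hconn hcons hgen hΦ]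

/-- **`Φ^tr_G|_{Exp C_σ} = x^{w^{(σ,z_Φ)}}`** — on the exponentiated Weyl chamber `x_{σ(1)} ≤ ⋯ ≤ x_{σ(n)}` the tropical approximation
of `Φ_G` is the single monomial whose exponent is the Fujishige–Tomizawa vertex of `𝒢_{z_Φ}` (proof of Theorem 27: "we have
vertices w^{(σ,z_ℬ)} ∈ ℬ … such that ⟨y, w^{(σ,z_ℬ)}⟩ = max_{v∈ℬ} ⟨y,v⟩ for all σ ∈ S_n and y ∈ C_σ", for `ℬ ∋ NP_{Φ_G}`).
[cite: Borinsky2020, proof of Theorem 27 (tropical.tex l.1075–1085); Theorem 32] -/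
theorem trop_secondSymanzikPolynomial_eq_prod_rpow_ftVertex (hconn : IsConnectedEdgeList E) {p : Fin (V + 1) → W}
    (hcons : ∑ v, p v = 0) (hgen : IsGenericMomenta p) {m : Fin N → ℝ} (hΦ : secondSymanzikPolynomial E p m ≠ 0)
    {σ : Equiv.Perm (Fin N)} {x : Fin N → ℝ} (hx : ∀ e, 0 < x e)
    (hmono : ∀ j j' : Fin N, j ≤ j' → x (σ j) ≤ x (σ j')) :
    trop (secondSymanzikPolynomial E p m) x = ∏ e, x e ^ ftVertex (zSecondSymanzik E p m) σ e := by
  have hz0 := zSecondSymanzik_empty (not_isMassMomentumSpanning_empty_of_ne_zero hcons hΦ)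
  have hxexp : x = fun e => Real.exp (Real.log (x e)) := funext fun e => (Real.exp_log (hx e)).symm
  have hy : (fun e => Real.log (x e)) ∈ weylChamber σ :=
    fun j j' hjj' => Real.log_le_log (hx _) (hmono j j' hjj')
  conv_lhs => rw [hxexp]
  rw [trop_secondSymanzikPolynomial_exp hconn hcons hgen hΦ,
    gpSupport_eq_inner_ftVertex (supermodular_zSecondSymanzik p m) hz0 hy, Real.exp_sum]
  refine Finset.prod_congr rfl fun e _ => ?_
  rw [Real.rpow_def_of_pos (hx e), mul_comm]

/-- `Π_e x_e^{1_S(e)} = Π_{e∈S} x_e`. Plumbing for the sector monomials. [folklore] -/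
private theorem prod_rpow_setIndicator (S : Finset (Fin N)) (x : Fin N → ℝ) :
    ∏ e, x e ^ setIndicator S e = ∏ e ∈ S, x e := by
  classical
  simp only [setIndicator]
  rw [← Finset.prod_filter_mul_prod_filter_not univ (fun e => e ∈ S), Finset.filter_mem_eq_inter,
    Finset.univ_inter]
  have h1 : ∏ e ∈ S, x e ^ (if e ∈ S then (1 : ℝ) else 0) = ∏ e ∈ S, x e :=
    Finset.prod_congr rfl fun e he => by rw [if_pos he, Real.rpow_one]
  have h2 : ∏ e ∈ univ.filter (fun e => ¬ e ∈ S), x e ^ (if e ∈ S then (1 : ℝ) else 0) = 1 :=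
    Finset.prod_eq_one fun e he => by rw [if_neg (Finset.mem_filter.1 he).2, Real.rpow_zero]
  rw [h1, h2, mul_one]

open scoped Classical in
/-- **THE HEPP-SECTOR MONOMIAL OF `Φ_G` FROM GRAPH DATA: `Φ^tr_G|_{Exp C_σ} = (Π_{e ∉ T_σ} x_e) · x_{σ(k)}`**, where `T_σ` is
Kruskal's spanning tree of the order `σ` (`|T_σ ∩ A^σ_i| = rk A^σ_i`, as for `Ψ^tr_G = Π_{e∉T_σ} x_e`, Panzer eq. (∗)) and `σ(k)`
is THE edge at which the chain `A^σ_0 ⊂ A^σ_1 ⊂ ⋯` first becomes mass-momentum spanning (`A^σ_{k−1}` not m.m., `A^σ_k` m.m.; unique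
by monotonicity) — the typed form of "a complete ordering of the integration parameters … is sufficient to capture the relevant
singularities of parametric integrals in the Euclidean non-exceptional case" (proof of Theorem 32, after Hepp and Speer), on the
CLOSED chamber of any order. [cite: Borinsky2020, Theorem 32 and its proof (tropical.tex l.1197–1213), Remark 33; Panzer2022, §2.2 eq. (∗); BorinskyMunchTellander2023, Theorem 3.5] -/
theorem trop_secondSymanzikPolynomial_eq_prod_compl_mul (hconn : IsConnectedEdgeList E) {p : Fin (V + 1) → W}
    (hcons : ∑ v, p v = 0) (hgen : IsGenericMomenta p) {m : Fin N → ℝ} (hΦ : secondSymanzikPolynomial E p m ≠ 0)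
    {σ : Equiv.Perm (Fin N)} {T : Finset (Fin N)}
    (hcount : ∀ k : ℕ, (T ∩ chainSet σ k).card = edgeRank E (chainSet σ k))
    {j : Fin N} (hj : ¬ IsMassMomentumSpanning E p m (chainSet σ j))
    (hj' : IsMassMomentumSpanning E p m (chainSet σ ((j : ℕ) + 1)))
    {x : Fin N → ℝ} (hx : ∀ e, 0 < x e) (hmono : ∀ i i' : Fin N, i ≤ i' → x (σ i) ≤ x (σ i')) :
    trop (secondSymanzikPolynomial E p m) x = (∏ e ∈ Tᶜ, x e) * x (σ j) := by
  have h0 := not_isMassMomentumSpanning_empty_of_ne_zero hcons hΦ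
  obtain ⟨j₀, hj₀, hj₀', hδ⟩ := exists_ftVertex_mmIndicator_eq hconn h0 σ
  have hjj : j = j₀ := by
    by_contra hne
    rcases lt_or_gt_of_ne (fun h : (j : ℕ) = j₀ => hne (Fin.ext h)) with hlt | hgt
    · exact hj₀ (hj'.mono (chainSet_mono σ (by omega)))
    · exact hj (hj₀'.mono (chainSet_mono σ (by omega)))
  subst hjj
  rw [trop_secondSymanzikPolynomial_eq_prod_rpow_ftVertex hconn hcons hgen hΦ hx hmono, zSecondSymanzik_eq_add,
    ftVertex_add, ftVertex_loopNumber_eq_setIndicator_compl E hcount, hδ]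
  simp only [Pi.add_apply]
  rw [Finset.prod_congr rfl fun e _ => Real.rpow_add (hx e) _ _, Finset.prod_mul_distrib,
    prod_rpow_setIndicator, prod_rpow_setIndicator, Finset.prod_singleton]

/-- **Hepp's sector degrees of `Φ_G`**: along the chain of `σ` the exponents of `Φ^tr|_{Exp C_σ}` telescope to `Σ_{e∈A^σ_k}
w^{(σ,z_Φ)}_e = z_Φ(A^σ_k) = ℓ(A^σ_k) + δ_{m.m.}(A^σ_k)` (Theorem 27's "⟨u^{(σ,k)}, w^{(σ,z_ℬ)}⟩ = −z_ℬ(A^σ_k)" for `ℬ ∋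
NP_{Φ_G}`): the classical infra-red-sensitive Hepp scaling `Φ_G ≍ Π_k t_k^{ℓ(γ_k) + δ_{m.m.}(γ_k)}` of the nested subgraphs
`γ_k = A^σ_k`. Requires non-trivial kinematics (`z_Φ(∅) = 0`). [cite: Borinsky2020, proof of Theorem 27 (tropical.tex l.1079), Theorem 32, §7.2 (δ_{m.m.}, l.1240–1241)] -/
theorem sum_chainSet_ftVertex_zSecondSymanzik {p : Fin (V + 1) → W} {m : Fin N → ℝ}
    (h0 : ¬ IsMassMomentumSpanning E p m ∅) (σ : Equiv.Perm (Fin N)) {k : ℕ} (hk : k ≤ N) :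
    ∑ i ∈ chainSet σ k, ftVertex (zSecondSymanzik E p m) σ i = zSecondSymanzik E p m (chainSet σ k) :=
  sum_chainSet_ftVertex _ σ (zSecondSymanzik_empty h0) hk

end Tropical

/-! ## Part 9 — §7.2's assembly with `Φ_G`: `𝒜`, `ℬ` and `r_G = z_𝒜 − z_ℬ` from graph data -/

section Assembly

variable {E}
variable {W : Type*} [NormedAddCommGroup W]

open MvPolynomial
open Literature.MathematicalPhysics.QuantumFieldTheory.Borinsky2020

/-- `c · NP_{Φ_G} = 𝒢_{c z_Φ}` for `c ≥ 0` (the dilate `ω(G) NP_{Φ_G}` in `ℬ`), `Φ_G ≠ 0`. [cite: Borinsky2020, §7.2 (tropical.tex l.1237–1239); Lemma 25] -/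
theorem smul_newtonPolytope_secondSymanzikPolynomial_eq_gpPolytope (hconn : IsConnectedEdgeList E) {p : Fin (V + 1) → W}
    (hcons : ∑ v, p v = 0) (hgen : IsGenericMomenta p) {m : Fin N → ℝ} (hΦ : secondSymanzikPolynomial E p m ≠ 0) {c : ℝ}
    (hc : 0 ≤ c) : c • NP⟦secondSymanzikPolynomial E p m⟧ = gpPolytope (c • zSecondSymanzik E p m) := by
  rw [newtonPolytope_secondSymanzikPolynomial_eq_gpPolytope hconn hcons hgen m,
    smul_gpPolytope (supermodular_zSecondSymanzik p m)
      (zSecondSymanzik_empty (not_isMassMomentumSpanning_empty_of_ne_zero hcons hΦ)) hc]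

/-- **`ℬ = ½D NP_{Ψ_G} + ω(G) NP_{Φ_G}` is the generalized permutahedron `𝒢_{(D/2)ℓ + ω z_Φ}`** ("ℬ = ½ D NP_{Ψ_G} + ω(G) NP_{Φ_G}
if ω(G) ≥ 0", §7.2; Lemma 25 and Theorem 32) — in exactly the hypothesis format `(Σ_j ρ_j • NP⟦b_j⟧) = gpPolytope z_ℬ` of
`GeneralizedPermutahedronSampling.lean` / `ConvergenceTheorem.lean`, for `D ≥ 0`, `ω(G) ≥ 0`, `Φ_G ≠ 0`.
[cite: Borinsky2020, §7.2 (tropical.tex l.1237–1241); Theorem 32; Lemma 25] -/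
theorem scriptB_eq_gpPolytope (hconn : IsConnectedEdgeList E) {p : Fin (V + 1) → W} (hcons : ∑ v, p v = 0)
    (hgen : IsGenericMomenta p) {m : Fin N → ℝ} (hΦ : secondSymanzikPolynomial E p m ≠ 0) {D ω : ℝ} (hD : 0 ≤ D)
    (hω : 0 ≤ ω) :
    (D / 2) • NP⟦kirchhoffPolynomial ℝ E⟧ + ω • NP⟦secondSymanzikPolynomial E p m⟧ =
      gpPolytope ((D / 2) • (fun γ : Finset (Fin N) => (loopNumber E γ : ℝ)) + ω • zSecondSymanzik E p m) := by
  have hz0 := zSecondSymanzik_empty (not_isMassMomentumSpanning_empty_of_ne_zero hcons hΦ)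
  have hD2 : 0 ≤ D / 2 := by positivity
  rw [smul_newtonPolytope_kirchhoffPolynomial_eq_gpPolytope E hconn hD2,
    smul_newtonPolytope_secondSymanzikPolynomial_eq_gpPolytope hconn hcons hgen hΦ hω,
    gpPolytope_add (supermodular_smul (supermodular_loopNumber E) hD2)
      (supermodular_smul (supermodular_zSecondSymanzik p m) hω) (by simp [loopNumber_empty]) (by simp [hz0])]

/-- **`𝒜 = Σ_e ν_e NP_{p_e} + ω(G) NP_{Ψ_G}` is the generalized permutahedron `𝒢_{z_ν + ω ℓ}`** ("𝒜 = Σ_e ν_e NP_{p_e} + ω(G)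
NP_{Ψ_G}", §7.2), for `ω(G) ≥ 0` — the hypothesis format `(Σ_i ν_i • NP⟦a_i⟧) = gpPolytope z_𝒜` of the sampling files.
[cite: Borinsky2020, §7.2 (tropical.tex l.1233–1241); Theorem 32; Lemma 25] -/
theorem scriptA_eq_gpPolytope (hconn : IsConnectedEdgeList E) (ν : Fin N → ℝ) {ω : ℝ} (hω : 0 ≤ ω) :
    (∑ e, ν e • NP⟦(X e : MvPolynomial (Fin N) ℝ)⟧) + ω • NP⟦kirchhoffPolynomial ℝ E⟧ =
      gpPolytope ((fun γ : Finset (Fin N) => ∑ e ∈ γ, ν e) +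
        ω • fun γ : Finset (Fin N) => (loopNumber E γ : ℝ)) := by
  rw [sum_smul_newtonPolytope_X_eq_gpPolytope, smul_newtonPolytope_kirchhoffPolynomial_eq_gpPolytope E hconn hω,
    gpPolytope_add (supermodular_sum_weights ν) (supermodular_smul (supermodular_loopNumber E) hω) (by simp)
      (by simp [loopNumber_empty])]

open scoped Classical in
/-- **`r_G(γ) = z_𝒜(γ) − z_ℬ(γ) = Σ_{e∈γ} ν_e − (D/2) ℓ(γ) − ω(G) δ_{m.m.}(γ)`** ("where δ_{m.m.}(γ) = 1 if γ is mass-momentum-spanning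
and 0 otherwise. Note that up to the δ_{m.m.}-term the function r_G(γ) is equal to the superficial degree of divergence ω(γ) of a
subgraph") — with the boolean functions of `scriptA_eq_gpPolytope` / `scriptB_eq_gpPolytope` this is the tree's `graphSdc E D ν γ`
(Panzer's `ω(γ)`, `HeppBound.lean`) minus `ω(G) δ_{m.m.}(γ)`: the infra-red correction to Euclidean power counting.
[cite: Borinsky2020, §7.2 (tropical.tex l.1240–1241); Panzer2022, §2.1 (ω)] -/
theorem scriptA_sub_scriptB_apply {p : Fin (V + 1) → W} {m : Fin N → ℝ} (D ω : ℝ) (ν : Fin N → ℝ)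
    (γ : Finset (Fin N)) :
    ((fun γ : Finset (Fin N) => ∑ e ∈ γ, ν e) + ω • fun γ : Finset (Fin N) => (loopNumber E γ : ℝ)) γ -
        ((D / 2) • (fun γ : Finset (Fin N) => (loopNumber E γ : ℝ)) + ω • zSecondSymanzik E p m) γ =
      graphSdc E D ν γ - ω * (if IsMassMomentumSpanning E p m γ then 1 else 0) := by
  rw [graphSdc_eq_weights_sub_smul_loopNumber]
  simp only [Pi.add_apply, Pi.smul_apply, smul_eq_mul, zSecondSymanzik_apply]
  ring

end Assembly

end Literature.MathematicalPhysics.QuantumFieldTheory
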